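import Literature.NumberTheory.LFunctions.DivisorSumCharSqSmoothedMoment
import Literature.NumberTheory.LFunctions.DirichletLFunctionPolyaVinogradovBound
import Mathlib.Analysis.Complex.Liouville
import Mathlib.Analysis.SpecialFunctions.Log.Deriv
import HarnessLib

/-!
# Zhang (2022), Lemma 3.1: `∑_{D⁴ < n ≤ P²} ν(n)²/n ≪ 𝓛^{-2011}` under (A), kernel-checked

Topic `Literature/NumberTheory/LFunctions/Zhang2022` (the Landau–Siegel autopsy tree). Everything in
this file is PROVED (theorems; the only definitions are explicit constants).

Source: Y. Zhang, *Discrete mean estimates and the Landau–Siegel zero*, arXiv:2211.02515v1 —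
**an unrefereed manuscript, a claimed result under adjudication in this tree** — §2 (2.1)
`𝓛 = log D`, (2.6) `P = exp(𝓛⁹)`, Assumption (A) "`L(1,χ) < 𝓛^{-2022}`" for `χ` a real primitive
character mod `D` (`D` large), §3 (3.1) `ν = 1 ∗ χ`, and

  **Lemma 3.1.** "Assume (A) holds. Then `∑_{D⁴ < n ≤ P²} ν(n)²/n ≪ 𝓛^{-2011}`. (3.2)"

What is proved here (`lemma_3_1`): there are absolute constants `C`, `L₀` such that for every
`D` with `log D ≥ L₀`, every primitive quadratic Dirichlet character `χ` mod `D` with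
`‖L(1,χ)‖ ≤ (log D)^{-2022}`, and every `N ≤ exp(2 (log D)⁹) = P²`,
`∑_{D⁴ < n ≤ N} |ν(n)|²/n ≤ C (log D)^{-2011}`.

The proof is the manuscript's (smoothing by `e^{-n/P²} − e^{-n/D⁴}`, Mellin, shift of the line,
residue at `s = 0` on the circle `|s| = α* = 𝓛^{-2024}` where `L(1+s,χ) ≪ 𝓛^{-2022}` by (A)),
organised through the tree's explicit formula
`Literature.NumberTheory.LFunctions.DivisorSumCharSq.explicit_formula`
(`DivisorSumCharSqSmoothedMoment.lean`):
`W_{ν²}(P²) − W_{ν²}(D⁴) = g(0)(W_d(P²) − W_d(D⁴)) + (log P² − log D⁴) g′(0) + (1/2π)∫_{re z = −1/4}`,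
with `g(z) = L(1+z,χ)² φ(1+z)`. The three terms are bounded by:
`|g(0)| ≤ 3 𝓛^{-4044}` and `W_d(Y) ≤ log²(1 + 2Y)` (`W_dCoeff_re_le`, from `d(n)e^{-n/Y} ≤
∑_{ab=n} e^{-(a+b)/2Y}` and `∑ e^{-n/2Y}/n = −log(1 − e^{-1/2Y})`); Cauchy's estimate on
`|z| = 𝓛^{-2024}` with `|L(1+z,χ)| ≤ |L(1,χ)| + |z| · sup |L′| ≤ (1 + 4e^{9/2}) 𝓛^{-2022}`
(`sup |L′| ≤ 2e^{9/2}(1+𝓛)𝓛` near `1`, by Cauchy from the tree's Pólya–Vinogradov-strength bound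
`DirichletAbel.norm_LFunction_le_rpow_polyaVinogradov`) and `|φ(1+z)| ≤ 3` there; and on the line
`re z = −1/4` the bound `|L(3/4+it,χ)| ≤ e^{3/2} D^{1/8} (1+𝓛)^{5/4} |s|`
(`DirichletAbel.norm_LFunction_le_polyaVinogradov_of_half_le`), `|φ| ≤ 3 · 4^{ω(D)} ≤ 3 d(D)²
≤ 3 C² D^{1/4}` (divisor bound with exponent `1/8`), `|P^{2z} − D^{4z}|/|z| ≤ 4(P^{-1/2} + D^{-1})
≤ 8 D^{-1}`, which give `O(D^{-1/2}(1+𝓛)³) = O(𝓛^{-2011})` (`𝓛 ≤ 4028 D^{1/4028}`).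
The smoothing step is `1_{(D⁴,P²]}(n) ≤ 6 (e^{-n/P²} − e^{-n/D⁴})` (`P² ≥ 4D⁴`).

This certifies the printed Lemma 3.1 as stated, with the printed exponent: the residue term is
`2𝓛⁹ · 3(1 + 4e^{9/2})² 𝓛^{2024} 𝓛^{-4044} = O(𝓛^{-2011})`, exactly the manuscript's count
"`𝓛^{2024} · 𝓛^{-4044} · 𝓛⁹`". The threshold is `log D ≥ 3`; the constant `C` is explicit in the
proof (it involves the divisor-bound constant of the tree's
`Literature.NumberTheory.Sieve.exists_card_divisors_le_mul_rpow`). It makes no statement about the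
manuscript's Theorems 1–2.

## References

* Y. Zhang, arXiv:2211.02515 (2022), §3, Lemma 3.1 and its proof.
  [cite: Zhang2022LandauSiegel, §3, Lemma 3.1]
-/

noncomputable section

open Complex Filter Topology Set MeasureTheory Real Metric
open scoped LSeries.notation

namespace Literature.NumberTheory.LFunctions.Zhang2022.Lemma31

open Literature.NumberTheory.LFunctions.DivisorSumCharSq
open Literature.NumberTheory.LFunctions.ZetaM4 (dCoeff dCoeff_apply norm_dCoeff_le_one_mul CΓ CΓ_pos
  norm_Gamma_strip_le pow_mul_exp_le integrable_pow_mul_exp integral_pow_mul_exp_le)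
open Literature.NumberTheory.LFunctions.HuxleyZeroDetection (smoothed)

/-! ### §1. `L(w, χ)` and `L′(w, χ)` near `w = 1` for a primitive character -/

section NearOne

variable {q : ℕ} [NeZero q] (χ : DirichletCharacter ℂ q)

/-- `∑_{n ≥ 1} n^{-(1 + 1/Lq)} ≤ 1 + Lq` for `Lq > 0` (Mathlib's Euler–Maclaurin identity
`ZetaAsymptotics.zeta_limit_aux1`). [folklore] -/
theorem tsum_succ_rpow_neg_one_add_inv_le {Lq : ℝ} (hL : 0 < Lq) :
    ∑' n : ℕ, ((n + 1 : ℕ) : ℝ) ^ (-(1 + 1 / Lq)) ≤ 1 + Lq := by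
  have hα : 1 < 1 + 1 / Lq := by have := one_div_pos.2 hL; linarith
  have h1 := ZetaAsymptotics.zeta_limit_aux1 hα
  have h2 : 0 ≤ ZetaAsymptotics.termTSum (1 + 1 / Lq) :=
    tsum_nonneg fun n ↦ ZetaAsymptotics.term_nonneg (n + 1) _
  have h3 : ∑' n : ℕ, ((n + 1 : ℕ) : ℝ) ^ (-(1 + 1 / Lq)) =
      ∑' n : ℕ, 1 / (n + 1 : ℝ) ^ (1 + 1 / Lq) := by
    refine tsum_congr fun n ↦ ?_
    rw [Real.rpow_neg (by positivity)]
    push_cast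
    simp only [one_div]
  have h4 : 0 ≤ (1 + 1 / Lq) * ZetaAsymptotics.termTSum (1 + 1 / Lq) :=
    mul_nonneg (by linarith) h2
  have h5 : 1 / (1 + 1 / Lq - 1) = Lq := by rw [add_sub_cancel_left, one_div_one_div]
  rw [h3]
  linarith

/-- Summability of `∑ (n+1)^{-a}` for `a > 1`. [folklore] -/
theorem summable_succ_rpow_neg {a : ℝ} (ha : 1 < a) :
    Summable fun n : ℕ => ((n + 1 : ℕ) : ℝ) ^ (-a) :=
  (summable_nat_add_iff 1).mpr (Real.summable_nat_rpow.mpr (by linarith))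

/-- **`Lq(w, χ)` near `w = 1`** for `χ` primitive mod `q` with `log q ≥ 3`: for `‖w − 1‖ ≤ 2/log q`,
`‖Lq(w, χ)‖ ≤ 2 e^{9/2} (1 + log q)` (the tree's Pólya–Vinogradov-strength bound
`DirichletAbel.norm_LFunction_le_rpow_polyaVinogradov` with `δq = 3/log q`). [folklore] -/
theorem norm_LFunction_le_near_one (hq : 3 ≤ Real.log q) (hχ : χ.IsPrimitive) {w : ℂ}
    (hw : ‖w - 1‖ ≤ 2 / Real.log q) :
    ‖χ.LFunction w‖ ≤ 2 * Real.exp (9 / 2) * (1 + Real.log q) := by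
  have hq2 : 2 ≤ q := by
    rcases Nat.lt_or_ge q 2 with h | h
    · interval_cases q <;> norm_num at hq
    · exact h
  set Lq : ℝ := Real.log q with hL
  have hL0 : 0 < Lq := by linarith
  have hq0 : (0 : ℝ) < q := by positivity
  have hre : 1 - 2 / Lq ≤ w.re := by
    have := abs_re_le_norm (w - 1)
    simp only [sub_re, one_re] at this
    have : |w.re - 1| ≤ 2 / Lq := this.trans hw
    linarith [neg_abs_le (w.re - 1)]
  have h2L : 2 / Lq ≤ 2 / 3 := div_le_div_of_nonneg_left (by norm_num) (by norm_num) hq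
  set δq : ℝ := 3 / Lq with hδq
  have hδq0 : 0 ≤ δq := by positivity
  have hδq1 : δq ≤ 1 := by rw [hδq, div_le_one hL0]; exact hq
  have hs0 : 0 < w.re := by linarith
  have h3L : 1 / Lq ≤ 1 / 3 := div_le_div_of_nonneg_left (by norm_num) (by norm_num) hq
  have hsum : 1 + 1 / Lq ≤ w.re + δq := by
    rw [hδq]; have : 3 / Lq = 2 / Lq + 1 / Lq := by ring
    linarith
  have hs : 1 < w.re + δq := by have := one_div_pos.2 hL0; linarith
  have hmain := DirichletAbel.norm_LFunction_le_rpow_polyaVinogradov χ hq2 hχ hδq0 hδq1 hs0 hs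
  -- the tail sum
  have htsum : ∑' n : ℕ, ((n + 1 : ℕ) : ℝ) ^ (-(w.re + δq)) ≤ 1 + Lq := by
    refine le_trans ?_ (tsum_succ_rpow_neg_one_add_inv_le hL0)
    refine Summable.tsum_le_tsum (fun n => ?_) (summable_succ_rpow_neg hs)
      (summable_succ_rpow_neg (by have := one_div_pos.2 hL0; linarith))
    exact Real.rpow_le_rpow_of_exponent_le (by exact_mod_cast Nat.le_add_left 1 n) (by linarith)
  -- `B^δq ≤ e^{9/2}`
  set B : ℝ := Real.sqrt q * (1 + Lq) with hB
  have hsqrt : 0 < Real.sqrt q := Real.sqrt_pos.2 hq0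
  have hB0 : 0 < B := mul_pos hsqrt (by linarith)
  have hlogB : Real.log B ≤ 3 / 2 * Lq := by
    have h1L : Real.log (1 + Lq) ≤ Lq := by
      calc Real.log (1 + Lq) ≤ Real.log (Real.exp Lq) :=
            Real.log_le_log (by linarith) (by linarith [Real.add_one_le_exp Lq])
        _ = Lq := Real.log_exp Lq
    rw [hB, Real.log_mul hsqrt.ne' (by linarith : (1 + Lq) ≠ 0), Real.log_sqrt hq0.le, ← hL]
    linarith
  have hBδq : B ^ δq ≤ Real.exp (9 / 2) := by
    rw [Real.rpow_def_of_pos hB0, Real.exp_le_exp, hδq]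
    calc Real.log B * (3 / Lq) ≤ 3 / 2 * Lq * (3 / Lq) :=
          mul_le_mul_of_nonneg_right hlogB (by positivity)
      _ = 9 / 2 := by field_simp; ring
  -- `‖w‖ ≤ 2`
  have hwn : ‖w‖ ≤ 2 := by
    have := norm_add_le (w - 1) 1
    rw [sub_add_cancel, norm_one] at this
    linarith
  have hE := Real.exp_pos (9 / 2)
  calc ‖χ.LFunction w‖ ≤ B ^ δq * ‖w‖ * ∑' n : ℕ, ((n + 1 : ℕ) : ℝ) ^ (-(w.re + δq)) := hmain
    _ ≤ Real.exp (9 / 2) * 2 * (1 + Lq) := by gcongr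
    _ = 2 * Real.exp (9 / 2) * (1 + Lq) := by ring

/-- A primitive character modulo `q ≥ 2` is non-trivial. [folklore] -/
theorem ne_one_of_isPrimitive (hq : 2 ≤ q) (hχ : χ.IsPrimitive) : χ ≠ 1 := by
  rintro rfl
  rw [DirichletCharacter.isPrimitive_def, DirichletCharacter.conductor_one] at hχ
  omega

/-- **`Lq′(w, χ)` near `w = 1`**: for `χ` primitive mod `q`, `log q ≥ 3`, `‖w − 1‖ ≤ 1/log q`,
`‖Lq′(w, χ)‖ ≤ 2 e^{9/2} (1 + log q) log q` (Cauchy's estimate on the circle of radius `1/log q`).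
[folklore] -/
theorem norm_deriv_LFunction_le_near_one (hq : 3 ≤ Real.log q) (hχ : χ.IsPrimitive) {w : ℂ}
    (hw : ‖w - 1‖ ≤ 1 / Real.log q) :
    ‖deriv χ.LFunction w‖ ≤ 2 * Real.exp (9 / 2) * (1 + Real.log q) * Real.log q := by
  have hq2 : 2 ≤ q := by
    rcases Nat.lt_or_ge q 2 with h | h
    · interval_cases q <;> norm_num at hq
    · exact h
  set Lq : ℝ := Real.log q with hL
  have hL0 : 0 < Lq := by linarith
  have hχ1 := ne_one_of_isPrimitive χ hq2 hχ
  have hR : 0 < 1 / Lq := one_div_pos.2 hL0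
  have hd : DiffContOnCl ℂ χ.LFunction (ball w (1 / Lq)) :=
    (DirichletCharacter.differentiable_LFunction hχ1).diffContOnCl
  have hM : ∀ z ∈ sphere w (1 / Lq), ‖χ.LFunction z‖ ≤ 2 * Real.exp (9 / 2) * (1 + Lq) := by
    intro z hz
    refine norm_LFunction_le_near_one χ hq hχ ?_
    rw [mem_sphere, dist_eq_norm] at hz
    calc ‖z - 1‖ = ‖(z - w) + (w - 1)‖ := by ring_nf
      _ ≤ ‖z - w‖ + ‖w - 1‖ := norm_add_le _ _
      _ ≤ 1 / Lq + 1 / Lq := add_le_add hz.le hw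
      _ = 2 / Real.log q := by rw [hL]; ring
  have := Complex.norm_deriv_le_of_forall_mem_sphere_norm_le hR hd hM
  calc ‖deriv χ.LFunction w‖ ≤ 2 * Real.exp (9 / 2) * (1 + Lq) / (1 / Lq) := this
    _ = 2 * Real.exp (9 / 2) * (1 + Lq) * Lq := by field_simp

/-- **`Lq(1+z, χ) − Lq(1, χ)`** for `‖z‖ ≤ 1/log q` (`χ` primitive, `log q ≥ 3`):
`‖Lq(1+z,χ) − Lq(1,χ)‖ ≤ 2 e^{9/2} (1 + log q) log q · ‖z‖` (mean value inequality). [folklore] -/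
theorem norm_LFunction_one_add_sub_le (hq : 3 ≤ Real.log q) (hχ : χ.IsPrimitive) {z : ℂ}
    (hz : ‖z‖ ≤ 1 / Real.log q) :
    ‖χ.LFunction (1 + z) - χ.LFunction 1‖ ≤
      2 * Real.exp (9 / 2) * (1 + Real.log q) * Real.log q * ‖z‖ := by
  have hq2 : 2 ≤ q := by
    rcases Nat.lt_or_ge q 2 with h | h
    · interval_cases q <;> norm_num at hq
    · exact h
  have hχ1 := ne_one_of_isPrimitive χ hq2 hχ
  have hconv : Convex ℝ (closedBall (1 : ℂ) (1 / Real.log q)) := convex_closedBall _ _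
  have h := hconv.norm_image_sub_le_of_norm_deriv_le (f := χ.LFunction)
    (fun x _ => (DirichletCharacter.differentiable_LFunction hχ1).differentiableAt)
    (fun x hx => norm_deriv_LFunction_le_near_one χ hq hχ (by
      rwa [mem_closedBall, dist_eq_norm] at hx))
    (mem_closedBall_self (le_of_lt (one_div_pos.2 (by linarith))))
    (show (1 : ℂ) + z ∈ closedBall (1 : ℂ) (1 / Real.log q) by
      rw [mem_closedBall, dist_eq_norm, add_sub_cancel_left]; exact hz)
  rwa [add_sub_cancel_left] at h

end NearOne

/-! ### §2. Realness: `ν(n)² = |ν(n)|²` for a quadratic character -/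

section Real

variable {D : ℕ} (χ : DirichletCharacter ℂ D)

/-- For `χ² = 1`, every value `χ(a)` is `0`, `1` or `−1`; in particular it is real. [folklore] -/
theorem apply_im_eq_zero (hχ : χ ^ 2 = 1) (a : ZMod D) : (χ a).im = 0 := by
  by_cases ha : IsUnit a
  · obtain ⟨u, rfl⟩ := ha
    have h : χ u * χ u = 1 := by
      have := congrArg (fun ψ : DirichletCharacter ℂ D => ψ u) hχ
      simpa [sq, MulChar.mul_apply] using this
    rcases mul_self_eq_one_iff.1 h with h1 | h1 <;> simp [h1]
  · rw [MulChar.map_nonunit _ ha]; simp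

/-- `ν(n)` is real for `χ² = 1`. [folklore] -/
theorem divisorSumChar_im_eq_zero (hχ : χ ^ 2 = 1) (n : ℕ) : (divisorSumChar χ n).im = 0 := by
  rw [divisorSumChar_apply, Complex.im_sum]
  exact Finset.sum_eq_zero fun d _ => apply_im_eq_zero χ hχ _

/-- `ν(n)² = |ν(n)|²` (as a complex number) for `χ² = 1`. [folklore] -/
theorem divisorSumChar_sq_eq (hχ : χ ^ 2 = 1) (n : ℕ) :
    divisorSumChar χ n ^ 2 = ((‖divisorSumChar χ n‖ ^ 2 : ℝ) : ℂ) := by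
  have him := divisorSumChar_im_eq_zero χ hχ n
  set v := divisorSumChar χ n with hv
  have hre : v = (v.re : ℂ) := by
    apply Complex.ext <;> simp [him]
  have hnorm : ‖v‖ = |v.re| := by
    rw [hre]; simp
  rw [hnorm, sq_abs, hre]
  push_cast
  simp [sq]

end Real

/-! ### §3. The smoothed sums are real; the smoothing inequality -/

section Smoothing

/-- For real coefficients `a(n)`, `W_a(Y) = ∑ a(n) e^{-n/Y}/n` is the real series. [folklore] -/
theorem W_ofReal (a : ℕ → ℝ) (Y : ℝ) :
    W (fun n => (a n : ℂ)) Y = ((∑' n : ℕ, a n * Real.exp (-(n / Y)) / n : ℝ) : ℂ) := by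
  rw [W_eq_tsum, Complex.ofReal_tsum]
  push_cast
  rfl

/-- The terms `‖f(n)‖ e^{-n/Y}/n`-type series are summable when `‖f(n)‖ ≤ C n`: here for real
`a(n)` with `|a(n)| ≤ C n` and `Y > 0`. [folklore] -/
theorem summable_mul_exp_div {a : ℕ → ℝ} {C : ℝ} (ha : ∀ n, |a n| ≤ C * n) {Y : ℝ} (hY : 0 < Y) :
    Summable fun n : ℕ => a n * Real.exp (-(n / Y)) / n := by
  have hC : 0 ≤ C := by
    have := ha 1; simp at this; exact (abs_nonneg _).trans this
  have hgeom : Summable fun n : ℕ => C * Real.exp (-(1 / Y)) ^ n :=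
    (summable_geometric_of_lt_one (Real.exp_pos _).le
      (Real.exp_lt_one_iff.2 (by have := one_div_pos.2 hY; linarith))).mul_left C
  refine hgeom.of_norm_bounded (fun n => ?_)
  rw [Real.norm_eq_abs]
  have hexp : Real.exp (-(n / Y)) = Real.exp (-(1 / Y)) ^ n := by
    rw [← Real.exp_nat_mul]; congr 1; field_simp
  rcases eq_or_ne n 0 with rfl | hn
  · simp [hC]
  have hn' : (0 : ℝ) < n := by positivity
  rw [abs_div, abs_mul, abs_of_pos (Real.exp_pos _), Nat.abs_cast, hexp,
    div_le_iff₀ hn']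
  calc |a n| * Real.exp (-(1 / Y)) ^ n ≤ C * n * Real.exp (-(1 / Y)) ^ n := by
        gcongr; exact ha n
    _ = C * Real.exp (-(1 / Y)) ^ n * n := by ring

/-- **The smoothing weight dominates the indicator**: for `0 < A`, `4A ≤ B`, `A < n ≤ B`,
`e^{-n/B} − e^{-n/A} ≥ 1/6`. [folklore] -/
theorem one_sixth_le_exp_sub_exp {A B n : ℝ} (hA : 0 < A) (hAB : 4 * A ≤ B) (hAn : A < n)
    (hnB : n ≤ B) : 1 / 6 ≤ Real.exp (-(n / B)) - Real.exp (-(n / A)) := by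
  have hB : 0 < B := by linarith
  have hn : 0 < n := hA.trans hAn
  -- `e^{-n/B} ≥ e^{-1} ≥ 1/3`
  have h1 : 1 / 3 ≤ Real.exp (-(n / B)) := by
    have hnB' : n / B ≤ 1 := (div_le_one hB).2 hnB
    calc (1 : ℝ) / 3 ≤ Real.exp (-1) := by
          rw [Real.exp_neg, one_div]
          exact inv_anti₀ (Real.exp_pos 1) (by have := Real.exp_one_lt_d9; linarith)
      _ ≤ Real.exp (-(n / B)) := Real.exp_le_exp.2 (by linarith)
  -- `e^{-n/A} ≤ e^{-n/B} e^{-3/4}` and `e^{-3/4} ≤ 1/2`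
  have h34 : Real.exp (-(3 / 4 : ℝ)) ≤ 1 / 2 := by
    rw [Real.exp_neg, one_div]
    refine inv_anti₀ (by norm_num) ?_
    have h2 : Real.log 2 ≤ 3 / 4 := by have := Real.log_two_lt_d9; linarith
    calc (2 : ℝ) = Real.exp (Real.log 2) := (Real.exp_log (by norm_num)).symm
      _ ≤ Real.exp (3 / 4) := Real.exp_le_exp.2 h2
  have h2 : Real.exp (-(n / A)) ≤ Real.exp (-(n / B)) * Real.exp (-(3 / 4 : ℝ)) := by
    rw [← Real.exp_add, Real.exp_le_exp]
    -- `n/A ≥ n/B + 3/4`: `n (1/A − 1/B) ≥ n · 3/(4A) ≥ 3/4`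
    have hAinv : 1 / B ≤ 1 / (4 * A) := div_le_div_of_nonneg_left (by norm_num) (by positivity) hAB
    have : n / A - n / B ≥ 3 / 4 := by
      have e1 : n / A - n / B = n * (1 / A - 1 / B) := by ring
      have e2 : 1 / A - 1 / B ≥ 3 / (4 * A) := by
        have : 3 / (4 * A) = 1 / A - 1 / (4 * A) := by field_simp; ring
        linarith
      have e3 : n * (3 / (4 * A)) ≥ 3 / 4 := by
        rw [ge_iff_le, show n * (3 / (4 * A)) = 3 / 4 * (n / A) by ring]
        have : 1 ≤ n / A := (one_le_div hA).2 hAn.le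
        nlinarith
      rw [e1]
      calc (3 : ℝ) / 4 ≤ n * (3 / (4 * A)) := e3
        _ ≤ n * (1 / A - 1 / B) := mul_le_mul_of_nonneg_left e2 hn.le
    linarith
  have hE := Real.exp_pos (-(n / B))
  nlinarith

end Smoothing

/-! ### §4. The divisor sum: `W_d(Y) ≤ log²(1 + 2Y)` -/

section Wd

/-- `S(Y) = −log(1 − e^{-1/(2Y)}) = ∑_{n ≥ 1} e^{-n/(2Y)}/n`. [folklore] -/
def Shalf (Y : ℝ) : ℝ := -Real.log (1 - Real.exp (-(1 / (2 * Y))))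

/-- `∑_{n ≥ 1} e^{-n/(2Y)}/n = S(Y)` (the logarithmic series). [folklore] -/
theorem hasSum_exp_div (Y : ℝ) (hY : 0 < Y) :
    HasSum (fun n : ℕ => Real.exp (-(n / (2 * Y))) / n) (Shalf Y) := by
  set x : ℝ := Real.exp (-(1 / (2 * Y))) with hx
  have hx0 : 0 < x := Real.exp_pos _
  have hx1 : x < 1 := Real.exp_lt_one_iff.2 (neg_lt_zero.2 (by positivity))
  have habs : |x| < 1 := by rw [abs_of_pos hx0]; exact hx1
  have h := Real.hasSum_pow_div_log_of_abs_lt_one habs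
  have hxn : ∀ n : ℕ, Real.exp (-(n / (2 * Y))) = x ^ n := by
    intro n
    rw [hx, ← Real.exp_nat_mul]
    congr 1
    ring
  set g : ℕ → ℝ := fun n => Real.exp (-(n / (2 * Y))) / n with hg
  have hg0 : g 0 = 0 := by simp [hg]
  have h1 : HasSum (fun n : ℕ => g (n + 1)) (Shalf Y) := by
    rw [Shalf, ← hx]
    convert h using 1
    funext n
    simp only [hg, hxn]
    push_cast
    ring
  have h2 := (hasSum_nat_add_iff 1).mp h1
  simpa [hg0] using h2

/-- `0 ≤ S(Y)`. [folklore] -/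
theorem Shalf_nonneg {Y : ℝ} (hY : 0 < Y) : 0 ≤ Shalf Y :=
  (hasSum_exp_div Y hY).nonneg fun n => by positivity

/-- `S(Y) ≤ log(1 + 2Y)` (`1 − e^{-u} ≥ u/(1+u)` with `u = 1/(2Y)`). [folklore] -/
theorem Shalf_le {Y : ℝ} (hY : 0 < Y) : Shalf Y ≤ Real.log (1 + 2 * Y) := by
  set u : ℝ := 1 / (2 * Y) with hu
  have hu0 : 0 < u := by positivity
  have hexp : Real.exp (-u) ≤ 1 / (1 + u) := by
    rw [Real.exp_neg, one_div]
    exact inv_anti₀ (by linarith) (by linarith [Real.add_one_le_exp u])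
  have h1 : 1 / (1 + 2 * Y) ≤ 1 - Real.exp (-u) := by
    have : 1 - 1 / (1 + u) = 1 / (1 + 2 * Y) := by
      rw [hu]; field_simp; ring
    linarith
  have hpos : 0 < 1 / (1 + 2 * Y) := by positivity
  rw [Shalf, ← hu, ← Real.log_inv]
  refine Real.log_le_log (inv_pos.2 (lt_of_lt_of_le hpos h1)) ?_
  calc (1 - Real.exp (-u))⁻¹ ≤ (1 / (1 + 2 * Y))⁻¹ := inv_anti₀ hpos h1
    _ = 1 + 2 * Y := by rw [one_div, inv_inv]

/-- The coefficients `e^{-n/(2Y)}`. [folklore] -/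
def fhalf (Y : ℝ) (n : ℕ) : ℂ := (Real.exp (-(n / (2 * Y))) : ℂ)

/-- `L(fhalf Y, 1) = S(Y)`, with convergence. [folklore] -/
theorem LSeriesHasSum_fhalf {Y : ℝ} (hY : 0 < Y) : LSeriesHasSum (fhalf Y) 1 (Shalf Y : ℂ) := by
  have h := hasSum_exp_div Y hY
  have hterm : LSeries.term (fhalf Y) 1 = fun n : ℕ => ((Real.exp (-(n / (2 * Y))) / n : ℝ) : ℂ) := by
    funext n
    rcases eq_or_ne n 0 with rfl | hn
    · simp
    · rw [LSeries.term_of_ne_zero hn, cpow_one, fhalf]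
      push_cast
      rfl
  rw [LSeriesHasSum, hterm]
  simpa using (Complex.ofRealCLM.hasSum h)

/-- For `ab = n` with `a, b ≥ 1`: `e^{-n/Y} ≤ e^{-(a+b)/(2Y)}` (`a + b ≤ 2ab`). [folklore] -/
theorem exp_le_exp_half {a b : ℕ} (ha : 1 ≤ a) (hb : 1 ≤ b) {Y : ℝ} (hY : 0 < Y) :
    Real.exp (-((a * b : ℕ) / Y)) ≤ Real.exp (-(a / (2 * Y))) * Real.exp (-(b / (2 * Y))) := by
  rw [← Real.exp_add, Real.exp_le_exp]
  have hab : (a : ℝ) + b ≤ 2 * (a * b : ℕ) := by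
    have : a + b ≤ 2 * (a * b) := by nlinarith
    exact_mod_cast this
  have h2Y : 0 < 2 * Y := by positivity
  rw [show -((a : ℝ) / (2 * Y)) + -((b : ℝ) / (2 * Y)) = -((a + b) / (2 * Y)) by ring, neg_le_neg_iff,
    div_le_div_iff₀ h2Y hY]
  nlinarith

/-- **`W_d(Y) ≤ log²(1 + 2Y)`** for `Y > 0`: `d(n) e^{-n/Y} ≤ ∑_{ab = n} e^{-(a+b)/(2Y)}`, so
`W_d(Y) ≤ (∑_{n≥1} e^{-n/(2Y)}/n)² = S(Y)² ≤ log²(1+2Y)`. [folklore] -/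
theorem W_dCoeff_re_le {Y : ℝ} (hY : 0 < Y) : (W dCoeff Y).re ≤ Real.log (1 + 2 * Y) ^ 2 := by
  -- the real series for `W_d`
  set t : ℕ → ℝ := fun n => (n.divisors.card : ℝ) * Real.exp (-(n / Y)) / n with ht
  have hdc : dCoeff = fun n => ((n.divisors.card : ℝ) : ℂ) := by
    funext n; rw [dCoeff_apply]; push_cast; rfl
  have hW : (W dCoeff Y).re = ∑' n, t n := by
    rw [hdc, W_ofReal]; simp [ht]
  have htsum : Summable t :=
    summable_mul_exp_div (C := 1) (fun n => by
      rw [Nat.abs_cast, one_mul]; exact_mod_cast Nat.card_divisors_le_self n) hY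
  -- the majorant series
  have hf := LSeriesHasSum_fhalf hY
  have hconv := hf.convolution hf
  set u : ℕ → ℝ := fun n => (LSeries.term (fhalf Y ⍟ fhalf Y) 1 n).re with hu
  have husum : HasSum u (((Shalf Y : ℂ) * (Shalf Y : ℂ))).re := Complex.hasSum_re hconv
  have hS2 : (((Shalf Y : ℂ) * (Shalf Y : ℂ))).re = Shalf Y ^ 2 := by
    rw [← ofReal_mul, ofReal_re, sq]
  -- termwise comparison
  have hle : ∀ n, t n ≤ u n := by
    intro n
    rcases eq_or_ne n 0 with rfl | hn
    · simp [ht, hu]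
    have hn' : (0 : ℝ) < n := by positivity
    rw [hu]
    simp only
    rw [LSeries.term_of_ne_zero hn, cpow_one, LSeries.convolution_def]
    simp only [fhalf]
    rw [show (∑ p ∈ n.divisorsAntidiagonal,
        ((Real.exp (-((p.1 : ℕ) / (2 * Y))) : ℝ) : ℂ) * ((Real.exp (-((p.2 : ℕ) / (2 * Y))) : ℝ) : ℂ)) =
        ((∑ p ∈ n.divisorsAntidiagonal,
          Real.exp (-((p.1 : ℕ) / (2 * Y))) * Real.exp (-((p.2 : ℕ) / (2 * Y))) : ℝ) : ℂ) by
      push_cast; rfl, show (n : ℂ) = ((n : ℝ) : ℂ) by norm_cast, ← ofReal_div, ofReal_re, ht]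
    simp only
    rw [div_le_div_iff_of_pos_right hn']
    -- `d(n) e^{-n/Y} = ∑_{(a,b)} e^{-n/Y} ≤ ∑_{(a,b)} e^{-a/2Y} e^{-b/2Y}`
    have hcard : (n.divisors.card : ℝ) * Real.exp (-(n / Y)) =
        ∑ p ∈ n.divisorsAntidiagonal, Real.exp (-(n / Y)) := by
      rw [Finset.sum_const, nsmul_eq_mul, ← Nat.map_div_right_divisors, Finset.card_map]
    rw [hcard]
    refine Finset.sum_le_sum fun p hp => ?_
    have hp' := Nat.mem_divisorsAntidiagonal.1 hp
    have ha : 1 ≤ p.1 := Nat.one_le_iff_ne_zero.2 (by rintro h; rw [h, zero_mul] at hp'; exact hn hp'.1.symm)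
    have hb : 1 ≤ p.2 := Nat.one_le_iff_ne_zero.2 (by rintro h; rw [h, mul_zero] at hp'; exact hn hp'.1.symm)
    have := exp_le_exp_half ha hb hY
    rw [hp'.1] at this
    exact this
  rw [hW]
  calc ∑' n, t n ≤ ∑' n, u n := Summable.tsum_le_tsum hle htsum husum.summable
    _ = Shalf Y ^ 2 := by rw [husum.tsum_eq, hS2]
    _ ≤ Real.log (1 + 2 * Y) ^ 2 := pow_le_pow_left₀ (Shalf_nonneg hY) (Shalf_le hY) 2

/-- `0 ≤ W_d(Y)`. [folklore] -/
theorem W_dCoeff_re_nonneg {Y : ℝ} : 0 ≤ (W dCoeff Y).re := by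
  have hdc : dCoeff = fun n => ((n.divisors.card : ℝ) : ℂ) := by
    funext n; rw [dCoeff_apply]; push_cast; rfl
  rw [hdc, W_ofReal, ofReal_re]
  exact tsum_nonneg fun n => by positivity

/-- `W_d(Y)` is real. [folklore] -/
theorem W_dCoeff_im {Y : ℝ} : (W dCoeff Y).im = 0 := by
  have hdc : dCoeff = fun n => ((n.divisors.card : ℝ) : ℂ) := by
    funext n; rw [dCoeff_apply]; push_cast; rfl
  rw [hdc, W_ofReal, ofReal_im]

/-- `‖W_d(B) − W_d(A)‖ ≤ log²(1 + 2B)` for `0 < A ≤ B`. [folklore] -/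
theorem norm_W_dCoeff_sub_le {A B : ℝ} (hA : 0 < A) (hAB : A ≤ B) :
    ‖W dCoeff B - W dCoeff A‖ ≤ Real.log (1 + 2 * B) ^ 2 := by
  have hB : 0 < B := lt_of_lt_of_le hA hAB
  have hre : W dCoeff B - W dCoeff A = (((W dCoeff B).re - (W dCoeff A).re : ℝ) : ℂ) := by
    apply Complex.ext <;> simp [W_dCoeff_im]
  rw [hre, Complex.norm_real, Real.norm_eq_abs]
  have h1 := W_dCoeff_re_le hB
  have h2 := W_dCoeff_re_le hA
  have h3 : Real.log (1 + 2 * A) ^ 2 ≤ Real.log (1 + 2 * B) ^ 2 :=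
    pow_le_pow_left₀ (Real.log_nonneg (by linarith)) (Real.log_le_log (by linarith) (by linarith)) 2
  have h4 := W_dCoeff_re_nonneg (Y := A)
  have h5 := W_dCoeff_re_nonneg (Y := B)
  rw [abs_le]; constructor <;> linarith

end Wd

/-! ### §5. `φ` near `1`, and `Φ_D ≤ 3 d(D)²` -/

section PhiNearOne

/-- For a prime `p ≤ N` and `‖z‖ ≤ 1/log N` (`log N ≥ 1`): `re p^{-(1+z)} ≥ 0`, hence
`‖1 + p^{-(1+z)}‖ ≥ 1`. [folklore] -/
theorem one_le_norm_one_add_cpow {N p : ℕ} (hp : p.Prime) (hpN : p ≤ N) (hN : 1 ≤ Real.log N)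
    {z : ℂ} (hz : ‖z‖ ≤ 1 / Real.log N) : 1 ≤ ‖1 + (p : ℂ) ^ (-(1 + z))‖ := by
  have hp0 : (0 : ℝ) < p := by exact_mod_cast hp.pos
  have hlogp : Real.log p ≤ Real.log N :=
    Real.log_le_log hp0 (by exact_mod_cast hpN)
  have hlogp0 : 0 ≤ Real.log p := Real.log_nonneg (by exact_mod_cast hp.one_lt.le)
  have hre : 0 ≤ ((p : ℂ) ^ (-(1 + z))).re := by
    rw [Complex.cpow_def_of_ne_zero (by exact_mod_cast hp.ne_zero), ← Complex.ofReal_natCast,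
      ← Complex.ofReal_log hp0.le, Complex.exp_re]
    refine mul_nonneg (Real.exp_pos _).le (Real.cos_nonneg_of_mem_Icc ⟨?_, ?_⟩)
    all_goals
      have him : (((Real.log p : ℝ) : ℂ) * -(1 + z)).im = -(Real.log p * z.im) := by
        rw [Complex.mul_im, Complex.ofReal_re, Complex.ofReal_im, Complex.neg_im, Complex.add_im,
          Complex.one_im, zero_mul, add_zero, zero_add, mul_neg]
      rw [him]
      have h1 : |Real.log p * z.im| ≤ 1 := by
        rw [abs_mul, abs_of_nonneg hlogp0]
        have hzim : |z.im| ≤ ‖z‖ := Complex.abs_im_le_norm z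
        have hL0 : 0 < Real.log N := by linarith
        calc Real.log p * |z.im| ≤ Real.log N * (1 / Real.log N) := by
              gcongr; exact hzim.trans hz
          _ = 1 := by field_simp
      have hπ : (1 : ℝ) ≤ π / 2 := by have := Real.pi_gt_three; linarith
      have := abs_le.1 h1
    · linarith [this.2]
    · linarith [this.1]
  calc (1 : ℝ) ≤ (1 + (p : ℂ) ^ (-(1 + z))).re := by
        rw [Complex.add_re, Complex.one_re]; linarith
    _ ≤ ‖1 + (p : ℂ) ^ (-(1 + z))‖ := Complex.re_le_norm _

/-- **`|φ(1+z)| ≤ 3`** for `‖z‖ ≤ min(1/log N, 1/4)`, `log N ≥ 1` (`|ζ(2+2z)|^{-1} ≤ 3` and every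
Euler factor `|1 + p^{-1-z}| ≥ 1`). [cite: Zhang2022LandauSiegel, §3 (3.3)] -/
theorem norm_phi_one_add_le {N : ℕ} (hN : 1 ≤ Real.log N) {z : ℂ} (hz : ‖z‖ ≤ 1 / Real.log N)
    (hz4 : ‖z‖ ≤ 1 / 4) : ‖phi N (1 + z)‖ ≤ 3 := by
  have hN0 : N ≠ 0 := by
    rintro rfl; simp at hN; linarith
  have hzre : -(1 / 4) ≤ z.re := by
    have := Complex.abs_re_le_norm z
    have := neg_abs_le z.re
    linarith
  have h2re : (2 * (1 + z) : ℂ).re = 2 + 2 * z.re := by simp; ring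
  have h2 : 1 < (2 * (1 + z) : ℂ).re := by rw [h2re]; linarith
  have hζ : ‖(riemannZeta (2 * (1 + z)))⁻¹‖ ≤ 3 := by
    refine (ZetaClassicalRegion.norm_inv_riemannZeta_le_of_one_lt_re h2).trans ?_
    rw [div_le_iff₀ (by linarith), h2re]
    linarith
  have hprod : 1 ≤ ‖∏ p ∈ N.primeFactors, (1 + (p : ℂ) ^ (-(1 + z)))‖ := by
    rw [norm_prod]
    calc (1 : ℝ) = ∏ p ∈ N.primeFactors, (1 : ℝ) := by simp
      _ ≤ ∏ p ∈ N.primeFactors, ‖1 + (p : ℂ) ^ (-(1 + z))‖ :=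
          Finset.prod_le_prod (fun _ _ => zero_le_one) fun p hp =>
            one_le_norm_one_add_cpow (Nat.prime_of_mem_primeFactors hp)
              (Nat.le_of_mem_primeFactors hp) hN hz
  rw [phi, mul_inv, norm_mul, norm_inv, norm_inv]
  rw [norm_inv] at hζ
  have hinv : ‖∏ p ∈ N.primeFactors, (1 + (p : ℂ) ^ (-(1 + z)))‖⁻¹ ≤ 1 :=
    inv_le_one_of_one_le₀ hprod
  calc ‖riemannZeta (2 * (1 + z))‖⁻¹ * ‖∏ p ∈ N.primeFactors, (1 + (p : ℂ) ^ (-(1 + z)))‖⁻¹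
      ≤ 3 * 1 := mul_le_mul hζ hinv (by positivity) (by norm_num)
    _ = 3 := by ring

/-- `2^{-3/4} ≤ 3/4` (since `(2^{-3/4})⁴ = 1/8 < (3/4)⁴`). [folklore] -/
theorem two_rpow_neg_three_quarters_le : (2 : ℝ) ^ (-(3 / 4 : ℝ)) ≤ 3 / 4 := by
  have h4 : ((2 : ℝ) ^ (-(3 / 4 : ℝ))) ^ 4 = 1 / 8 := by
    rw [← Real.rpow_natCast, ← Real.rpow_mul (by norm_num)]
    norm_num
  have hpos : 0 ≤ (2 : ℝ) ^ (-(3 / 4 : ℝ)) := Real.rpow_nonneg (by norm_num) _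
  by_contra h
  push Not at h
  have : ((3 : ℝ) / 4) ^ 4 < ((2 : ℝ) ^ (-(3 / 4 : ℝ))) ^ 4 := pow_lt_pow_left₀ h (by norm_num) (by norm_num)
  rw [h4] at this
  norm_num at this

/-- **`Φ_D ≤ 3 d(D)²`**: `(1 − 2^{-3/4})^{-ω(D)} ≤ 4^{ω(D)} ≤ d(D)²`. [folklore] -/
theorem phiBound_le {D : ℕ} (hD : D ≠ 0) : phiBound D ≤ 3 * (D.divisors.card : ℝ) ^ 2 := by
  have hc : (1 : ℝ) / 4 ≤ 1 - (2 : ℝ) ^ (-(3 / 4 : ℝ)) := by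
    have := two_rpow_neg_three_quarters_le; linarith
  have h2 : 2 ^ D.primeFactors.card ≤ D.divisors.card := by
    rw [Nat.card_divisors hD]
    refine Finset.pow_card_le_prod _ _ _ fun p hp => ?_
    have hp := Nat.mem_primeFactors.mp hp
    have hpos : 0 < D.factorization p := hp.1.factorization_pos_of_dvd hD hp.2.1
    omega
  have h2' : (2 : ℝ) ^ D.primeFactors.card ≤ (D.divisors.card : ℝ) := by exact_mod_cast h2
  unfold phiBound
  have hk : ((1 : ℝ) / 4) ^ D.primeFactors.card ≤ (1 - (2 : ℝ) ^ (-(3 / 4 : ℝ))) ^ D.primeFactors.card :=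
    pow_le_pow_left₀ (by norm_num) hc _
  have hinv : ((1 - (2 : ℝ) ^ (-(3 / 4 : ℝ))) ^ D.primeFactors.card)⁻¹ ≤ (4 : ℝ) ^ D.primeFactors.card := by
    calc ((1 - (2 : ℝ) ^ (-(3 / 4 : ℝ))) ^ D.primeFactors.card)⁻¹ ≤ (((1 : ℝ) / 4) ^ D.primeFactors.card)⁻¹ :=
          inv_anti₀ (by positivity) hk
      _ = (4 : ℝ) ^ D.primeFactors.card := by rw [← inv_pow]; norm_num
  calc 3 * ((1 - (2 : ℝ) ^ (-(3 / 4 : ℝ))) ^ D.primeFactors.card)⁻¹ ≤ 3 * (4 : ℝ) ^ D.primeFactors.card := by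
        gcongr
    _ = 3 * ((2 : ℝ) ^ D.primeFactors.card) ^ 2 := by
        rw [← pow_mul, mul_comm (D.primeFactors.card) 2, pow_mul]; norm_num
    _ ≤ 3 * (D.divisors.card : ℝ) ^ 2 := by gcongr

end PhiNearOne

/-! ### §6. The smoothed second moment of `ν` is a real series; the smoothing step -/

section NuSq

variable {D : ℕ} (χ : DirichletCharacter ℂ D)

/-- `W_{ν²}(Y)` is the real series `∑ |ν(n)|² e^{-n/Y}/n` (for `χ² = 1`). [folklore] -/
theorem W_nuSq_eq (hχ : χ ^ 2 = 1) (Y : ℝ) :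
    W (fun n => divisorSumChar χ n ^ 2) Y =
      ((∑' n : ℕ, ‖divisorSumChar χ n‖ ^ 2 * Real.exp (-(n / Y)) / n : ℝ) : ℂ) := by
  have : (fun n => divisorSumChar χ n ^ 2) = fun n => ((‖divisorSumChar χ n‖ ^ 2 : ℝ) : ℂ) :=
    funext (divisorSumChar_sq_eq χ hχ)
  rw [this, W_ofReal]

/-- Summability of `∑ |ν(n)|² e^{-n/Y}/n` for `Y > 0`. [folklore] -/
theorem summable_nuSq {Y : ℝ} (hY : 0 < Y) :
    Summable fun n : ℕ => ‖divisorSumChar χ n‖ ^ 2 * Real.exp (-(n / Y)) / n := by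
  obtain ⟨C, hC⟩ := exists_norm_divisorSumChar_sq_le χ
  refine summable_mul_exp_div (C := C) (fun n => ?_) hY
  rw [abs_of_nonneg (by positivity), ← norm_pow]
  exact hC n

/-- **The smoothing step**: for `0 < A ≤ M`, `4A ≤ B`, `N ≤ B`,
`∑_{M < n ≤ N} |ν(n)|²/n ≤ 6 · re (W_{ν²}(B) − W_{ν²}(A))`. [cite: Zhang2022LandauSiegel, §3, proof
of Lemma 3.1] -/
theorem sum_Ioc_le (hχ : χ ^ 2 = 1) {A B : ℝ} (hA : 0 < A) (hAB : 4 * A ≤ B) {M N : ℕ}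
    (hM : A ≤ M) (hN : (N : ℝ) ≤ B) :
    ∑ n ∈ Finset.Ioc M N, ‖divisorSumChar χ n‖ ^ 2 / n ≤
      6 * (W (fun n => divisorSumChar χ n ^ 2) B - W (fun n => divisorSumChar χ n ^ 2) A).re := by
  have hB : 0 < B := by linarith
  set a : ℕ → ℝ := fun n => ‖divisorSumChar χ n‖ ^ 2 * (Real.exp (-(n / B)) - Real.exp (-(n / A))) / n
    with ha
  have hsB := summable_nuSq χ hB
  have hsA := summable_nuSq χ hA
  have hre : (W (fun n => divisorSumChar χ n ^ 2) B - W (fun n => divisorSumChar χ n ^ 2) A).re =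
      ∑' n, a n := by
    rw [W_nuSq_eq χ hχ, W_nuSq_eq χ hχ, ← ofReal_sub, ofReal_re, ← hsB.tsum_sub hsA]
    refine tsum_congr fun n => ?_
    simp only [ha]; ring
  have ha0 : ∀ n, 0 ≤ a n := by
    intro n
    have : Real.exp (-(n / A)) ≤ Real.exp (-(n / B)) := by
      rw [Real.exp_le_exp, neg_le_neg_iff]
      exact div_le_div_of_nonneg_left (Nat.cast_nonneg n) hA (by linarith)
    simp only [ha]
    exact div_nonneg (mul_nonneg (sq_nonneg _) (by linarith)) (Nat.cast_nonneg n)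
  have hsa : Summable a := by
    have : a = fun n => ‖divisorSumChar χ n‖ ^ 2 * Real.exp (-(n / B)) / n -
        ‖divisorSumChar χ n‖ ^ 2 * Real.exp (-(n / A)) / n := by
      funext n; simp only [ha]; ring
    rw [this]; exact hsB.sub hsA
  rw [hre]
  calc ∑ n ∈ Finset.Ioc M N, ‖divisorSumChar χ n‖ ^ 2 / n ≤ ∑ n ∈ Finset.Ioc M N, 6 * a n := by
        refine Finset.sum_le_sum fun n hn => ?_
        rw [Finset.mem_Ioc] at hn
        have hAn : A < n := lt_of_le_of_lt hM (by exact_mod_cast hn.1)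
        have hnB : (n : ℝ) ≤ B := le_trans (by exact_mod_cast hn.2) hN
        have hw := one_sixth_le_exp_sub_exp hA hAB hAn hnB
        have hn0 : (0 : ℝ) < n := hA.trans hAn
        simp only [ha]
        rw [mul_div_assoc', div_le_div_iff_of_pos_right hn0]
        have h0 : 0 ≤ ‖divisorSumChar χ n‖ ^ 2 := sq_nonneg _
        nlinarith
    _ = 6 * ∑ n ∈ Finset.Ioc M N, a n := by rw [Finset.mul_sum]
    _ ≤ 6 * ∑' n, a n := by
        gcongr
        exact hsa.sum_le_tsum _ fun n _ => ha0 n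

end NuSq

/-! ### §7. Cauchy's estimate for `g′(0)` -/

section Deriv

variable {D : ℕ} [NeZero D] (χ : DirichletCharacter ℂ D)

/-- **`|g′(0)| ≤ 3 (|L(1,χ)| + 2e^{9/2}(1+𝓛)𝓛 r)²/r`** for `χ` primitive mod `D`, `𝓛 = log D ≥ 3`,
`0 < r ≤ min(1/𝓛, 1/4)` (Cauchy's estimate on `|z| = r`, where `|φ(1+z)| ≤ 3` and
`|L(1+z,χ)| ≤ |L(1,χ)| + r sup|L′|`). [cite: Zhang2022LandauSiegel, §3, proof of Lemma 3.1] -/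
theorem norm_deriv_gFun_zero_le (hprim : χ.IsPrimitive) (hD : 3 ≤ Real.log D) {r : ℝ}
    (hr0 : 0 < r) (hr1 : r ≤ 1 / Real.log D) (hr4 : r ≤ 1 / 4) :
    ‖deriv (gFun χ) 0‖ ≤
      3 * (‖χ.LFunction 1‖ + 2 * Real.exp (9 / 2) * (1 + Real.log D) * Real.log D * r) ^ 2 / r := by
  have hq2 : 2 ≤ D := by
    rcases Nat.lt_or_ge D 2 with h | h
    · interval_cases D <;> norm_num at hD
    · exact h
  have hχ1 := ne_one_of_isPrimitive χ hq2 hprim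
  have hlog1 : 1 ≤ Real.log D := by linarith
  set CL : ℝ := 2 * Real.exp (9 / 2) * (1 + Real.log D) * Real.log D with hCL
  have hCL0 : 0 ≤ CL := by positivity
  have hd : DiffContOnCl ℂ (gFun χ) (ball 0 r) := by
    refine (differentiableOn_gFun χ hχ1).diffContOnCl_ball fun z hz => ?_
    rw [mem_closedBall, dist_zero_right] at hz
    simp only [mem_setOf_eq]
    have := Complex.abs_re_le_norm z
    have := neg_abs_le z.re
    linarith
  have hM : ∀ z ∈ sphere (0 : ℂ) r, ‖gFun χ z‖ ≤ 3 * (‖χ.LFunction 1‖ + CL * r) ^ 2 := by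
    intro z hz
    rw [mem_sphere, dist_zero_right] at hz
    have hzr : ‖z‖ ≤ 1 / Real.log D := by rw [hz]; exact hr1
    have hL : ‖χ.LFunction (1 + z)‖ ≤ ‖χ.LFunction 1‖ + CL * r := by
      have hsub := norm_LFunction_one_add_sub_le χ hD hprim hzr
      rw [hz] at hsub
      have := norm_add_le (χ.LFunction (1 + z) - χ.LFunction 1) (χ.LFunction 1)
      rw [sub_add_cancel] at this
      linarith
    have hφ := norm_phi_one_add_le (N := D) hlog1 hzr (by rw [hz]; exact hr4)
    rw [gFun, norm_mul, norm_pow]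
    have h0 : 0 ≤ ‖χ.LFunction (1 + z)‖ := norm_nonneg _
    calc ‖χ.LFunction (1 + z)‖ ^ 2 * ‖phi D (1 + z)‖ ≤ (‖χ.LFunction 1‖ + CL * r) ^ 2 * 3 := by
          gcongr
      _ = 3 * (‖χ.LFunction 1‖ + CL * r) ^ 2 := by ring
  exact Complex.norm_deriv_le_of_forall_mem_sphere_norm_le hr0 hd hM

end Deriv

/-! ### §8. The shifted integral on `re z = −1/4`, with the `D`-dependence explicit -/

section LineBound

variable {D : ℕ} [NeZero D] (χ : DirichletCharacter ℂ D)

/-- The absolute constant of the line bound. [folklore] -/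
def Kline : ℝ := 5 ^ 8 * 480 * Real.exp 3 * CΓ

omit [NeZero D] in
/-- `Kline > 0`. [folklore] -/
theorem Kline_pos : 0 < Kline := by unfold Kline; have := CΓ_pos; positivity

omit [NeZero D] in
/-- `((√D (1+𝓛))^{1/4})² ≤ D^{1/4} (1 + 𝓛)`. [folklore] -/
theorem sqrt_mul_rpow_quarter_sq_le (hD : 0 < (D : ℝ)) (hL : 0 ≤ Real.log D) :
    ((Real.sqrt D * (1 + Real.log D)) ^ (1 / 4 : ℝ)) ^ 2 ≤
      (D : ℝ) ^ (1 / 4 : ℝ) * (1 + Real.log D) := by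
  have h1 : 0 ≤ Real.sqrt D * (1 + Real.log D) := by positivity
  rw [← Real.rpow_natCast, ← Real.rpow_mul h1]
  norm_num
  rw [Real.mul_rpow (Real.sqrt_nonneg _) (by linarith), Real.sqrt_eq_rpow, ← Real.rpow_mul hD.le]
  norm_num
  refine mul_le_mul_of_nonneg_left ?_ (by positivity)
  calc (1 + Real.log D) ^ (1 / 2 : ℝ) ≤ (1 + Real.log D) ^ (1 : ℝ) :=
        Real.rpow_le_rpow_of_exponent_le (by linarith) (by norm_num)
    _ = 1 + Real.log D := Real.rpow_one _

/-- **`g` on the line `re z = −1/4`** (`χ` primitive mod `D ≥ 8`):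
`‖g(z)‖ ≤ 27 e³ d(D)² D^{1/4} (1+𝓛)³ (1+|im z|)²` (`L(3/4+it,χ)` by the tree's Pólya–Vinogradov
convexity bound, `|φ| ≤ Φ_D ≤ 3 d(D)²`). [cite: Zhang2022LandauSiegel, §3, proof of Lemma 3.1] -/
theorem norm_gFun_line_le (hprim : χ.IsPrimitive) (hD8 : 8 ≤ D) {z : ℂ} (hzre : z.re = -(1 / 4)) :
    ‖gFun χ z‖ ≤ 27 * (Real.exp 3 * (D.divisors.card : ℝ) ^ 2 * (D : ℝ) ^ (1 / 4 : ℝ) *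
      (1 + Real.log D) ^ 3 * (1 + |z.im|) ^ 2) := by
  have hD0 : D ≠ 0 := by omega
  have hDpos : (0 : ℝ) < D := by exact_mod_cast Nat.pos_of_ne_zero hD0
  have hlog0 : 0 ≤ Real.log D := Real.log_nonneg (by exact_mod_cast Nat.one_le_iff_ne_zero.2 hD0)
  have hy0 := abs_nonneg z.im
  have hzn : ‖z‖ ≤ 1 / 4 + |z.im| := by
    have := Complex.norm_le_abs_re_add_abs_im z
    rw [hzre, abs_neg, abs_of_pos (by norm_num : (0:ℝ) < 1 / 4)] at this
    exact this
  have h1z : ‖(1 : ℂ) + z‖ ≤ 3 * (1 + |z.im|) := by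
    have := norm_add_le (1 : ℂ) z
    rw [norm_one] at this
    linarith
  have hsre : ((1 : ℂ) + z).re = 3 / 4 := by rw [add_re, one_re, hzre]; norm_num
  have h := DirichletAbel.norm_LFunction_le_polyaVinogradov_of_half_le χ hD8 hprim (s := 1 + z)
    (by rw [hsre]; norm_num) (by rw [hsre]; norm_num)
  rw [hsre, show (1 : ℝ) - 3 / 4 = 1 / 4 by norm_num] at h
  have h0 : 0 ≤ ‖χ.LFunction (1 + z)‖ := norm_nonneg _
  have hX := sqrt_mul_rpow_quarter_sq_le (D := D) hDpos hlog0
  have he : Real.exp (3 / 2) ^ 2 = Real.exp 3 := by rw [← Real.exp_nat_mul]; norm_num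
  have hL : ‖χ.LFunction (1 + z)‖ ^ 2 ≤
      Real.exp 3 * ((D : ℝ) ^ (1 / 4 : ℝ) * (1 + Real.log D)) * (1 + Real.log D) ^ 2 *
        (3 * (1 + |z.im|)) ^ 2 := by
    calc ‖χ.LFunction (1 + z)‖ ^ 2
        ≤ (Real.exp (3 / 2) * (Real.sqrt D * (1 + Real.log D)) ^ (1 / 4 : ℝ) * (1 + Real.log D) *
            ‖(1 : ℂ) + z‖) ^ 2 := pow_le_pow_left₀ h0 h 2
      _ = Real.exp (3 / 2) ^ 2 * ((Real.sqrt D * (1 + Real.log D)) ^ (1 / 4 : ℝ)) ^ 2 *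
            (1 + Real.log D) ^ 2 * ‖(1 : ℂ) + z‖ ^ 2 := by ring
      _ ≤ Real.exp 3 * ((D : ℝ) ^ (1 / 4 : ℝ) * (1 + Real.log D)) * (1 + Real.log D) ^ 2 *
            (3 * (1 + |z.im|)) ^ 2 := by
          rw [he]
          have h1 : 0 ≤ Real.exp 3 := (Real.exp_pos 3).le
          have h2 : 0 ≤ (1 + Real.log D) ^ 2 := sq_nonneg _
          have h3 : ‖(1 : ℂ) + z‖ ^ 2 ≤ (3 * (1 + |z.im|)) ^ 2 := pow_le_pow_left₀ (norm_nonneg _) h1z 2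
          have h4 := mul_le_mul hX h3 (sq_nonneg _) (by positivity)
          calc Real.exp 3 * ((Real.sqrt D * (1 + Real.log D)) ^ (1 / 4 : ℝ)) ^ 2 *
                (1 + Real.log D) ^ 2 * ‖(1 : ℂ) + z‖ ^ 2
              = Real.exp 3 * (1 + Real.log D) ^ 2 *
                  (((Real.sqrt D * (1 + Real.log D)) ^ (1 / 4 : ℝ)) ^ 2 * ‖(1 : ℂ) + z‖ ^ 2) := by ring
            _ ≤ Real.exp 3 * (1 + Real.log D) ^ 2 *
                  ((D : ℝ) ^ (1 / 4 : ℝ) * (1 + Real.log D) * (3 * (1 + |z.im|)) ^ 2) :=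
                mul_le_mul_of_nonneg_left h4 (by positivity)
            _ = _ := by ring
  have hφz : ‖phi D (1 + z)‖ ≤ 3 * (D.divisors.card : ℝ) ^ 2 :=
    (norm_phi_le (N := D) (w := 1 + z) (by rw [hsre])).trans (phiBound_le hD0)
  rw [gFun, norm_mul, norm_pow]
  calc ‖χ.LFunction (1 + z)‖ ^ 2 * ‖phi D (1 + z)‖
      ≤ (Real.exp 3 * ((D : ℝ) ^ (1 / 4 : ℝ) * (1 + Real.log D)) * (1 + Real.log D) ^ 2 *
          (3 * (1 + |z.im|)) ^ 2) * (3 * (D.divisors.card : ℝ) ^ 2) :=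
        mul_le_mul hL hφz (norm_nonneg _) (by positivity)
    _ = _ := by ring

/-- `‖g(0)‖ ≤ 3` when `‖L(1,χ)‖ ≤ 1` and `log D ≥ 1`. [folklore] -/
theorem norm_gFun_zero_le (hlog : 1 ≤ Real.log D) (hL1 : ‖χ.LFunction 1‖ ≤ 1) :
    ‖gFun χ 0‖ ≤ 3 := by
  have hφ1 : ‖phi D (1 + 0)‖ ≤ 3 :=
    norm_phi_one_add_le (N := D) hlog (by rw [norm_zero]; positivity) (by rw [norm_zero]; norm_num)
  rw [gFun, norm_mul, norm_pow]
  have : ‖χ.LFunction (1 + 0)‖ ^ 2 ≤ 1 := by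
    rw [add_zero]; exact pow_le_one₀ (norm_nonneg _) hL1
  calc ‖χ.LFunction (1 + 0)‖ ^ 2 * ‖phi D (1 + 0)‖ ≤ 1 * 3 :=
        mul_le_mul this hφ1 (norm_nonneg _) (by norm_num)
    _ = 3 := by ring

/-- **The numerator on the line `re z = −1/4`** (`χ` primitive mod `D ≥ 8`, `‖L(1,χ)‖ ≤ 1`,
`log D ≥ 1`): `‖N(−1/4+iy)‖ ≤ K d(D)² D^{1/4} (1+𝓛)³ (A^{-1/4} + B^{-1/4}) (1+|y|)¹³ e^{-π|y|/2}`.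
[cite: Zhang2022LandauSiegel, §3, proof of Lemma 3.1] -/
theorem norm_numer_line_le (hprim : χ.IsPrimitive) (hD8 : 8 ≤ D) (hlog : 1 ≤ Real.log D)
    (hL1 : ‖χ.LFunction 1‖ ≤ 1) {A B : ℝ} (hA : 0 < A) (hB : 0 < B) (y : ℝ) :
    ‖numer χ A B (((-(1 / 4) : ℝ) : ℂ) + y * I)‖ ≤
      Kline * (D.divisors.card : ℝ) ^ 2 * (D : ℝ) ^ (1 / 4 : ℝ) * (1 + Real.log D) ^ 3 *
        (A ^ (-(1 / 4) : ℝ) + B ^ (-(1 / 4) : ℝ)) * ((1 + |y|) ^ 13 * Real.exp (-(π * |y| / 2))) := by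
  have hD0 : D ≠ 0 := by omega
  generalize hzdef : (((-(1 / 4) : ℝ) : ℂ) + y * I) = z
  have hzre : z.re = -(1 / 4) := by rw [← hzdef]; simp
  have hzim : z.im = y := by rw [← hzdef]; simp
  have hy0 := abs_nonneg y
  have hz : 1 / 4 ≤ ‖z‖ := by
    have := Complex.abs_re_le_norm z
    rw [hzre, abs_neg, abs_of_pos (by norm_num : (0:ℝ) < 1 / 4)] at this
    exact this
  have hz0 : z ≠ 0 := by
    intro h; rw [h, norm_zero] at hz; norm_num at hz
  have hzn : ‖z‖ ≤ 1 / 4 + |y| := by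
    have := Complex.norm_le_abs_re_add_abs_im z
    rw [hzre, hzim, abs_neg, abs_of_pos (by norm_num : (0:ℝ) < 1 / 4)] at this
    exact this
  have h1z : ‖(1 : ℂ) + z‖ ≤ 3 * (1 + |y|) := by
    have := norm_add_le (1 : ℂ) z
    rw [norm_one] at this
    linarith
  -- ζ₁
  have hζ : ‖riemannZeta₁ (1 + z)‖ ≤ 5 ^ 4 * (1 + |y|) ^ 4 := by
    have h := BurnolVectors.norm_riemannZeta₁_le (s := 1 + z) (by rw [add_re, one_re, hzre]; norm_num)
    refine h.trans ?_
    have : ‖(1 : ℂ) + z‖ + 2 ≤ 5 * (1 + |y|) := by linarith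
    calc (‖(1 : ℂ) + z‖ + 2) ^ 4 ≤ (5 * (1 + |y|)) ^ 4 := by gcongr
      _ = 5 ^ 4 * (1 + |y|) ^ 4 := by ring
  have hζ2 : ‖riemannZeta₁ (1 + z)‖ ^ 2 ≤ 5 ^ 8 * (1 + |y|) ^ 8 := by
    calc ‖riemannZeta₁ (1 + z)‖ ^ 2 ≤ (5 ^ 4 * (1 + |y|) ^ 4) ^ 2 := pow_le_pow_left₀ (norm_nonneg _) hζ 2
      _ = 5 ^ 8 * (1 + |y|) ^ 8 := by ring
  -- Γ
  have hΓ : ‖Complex.Gamma (z + 1)‖ ≤ CΓ * (1 + |y|) ^ 3 * Real.exp (-(π * |y| / 2)) := by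
    have := norm_Gamma_strip_le (x := z.re + 1) (by rw [hzre]; norm_num) (by rw [hzre]; norm_num) z.im
    have e : ((z.re + 1 : ℝ) : ℂ) + z.im * I = z + 1 := by
      rw [show ((z.re + 1 : ℝ) : ℂ) = (z.re : ℂ) + 1 by push_cast; ring]
      conv_rhs => rw [← Complex.re_add_im z]
      ring
    rwa [e, hzim] at this
  -- ε
  have hε : ‖eps A B z‖ ≤ 4 * (A ^ (-(1 / 4) : ℝ) + B ^ (-(1 / 4) : ℝ)) := by
    rw [eps_of_ne_zero _ _ hz0, norm_div, div_le_iff₀ (by linarith)]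
    have hnum : ‖(B : ℂ) ^ z - (A : ℂ) ^ z‖ ≤ A ^ (-(1 / 4) : ℝ) + B ^ (-(1 / 4) : ℝ) := by
      refine (norm_sub_le _ _).trans ?_
      rw [Complex.norm_cpow_eq_rpow_re_of_pos hB, Complex.norm_cpow_eq_rpow_re_of_pos hA, hzre]
      linarith
    have h0 : 0 ≤ A ^ (-(1 / 4) : ℝ) + B ^ (-(1 / 4) : ℝ) := by positivity
    nlinarith
  -- dslope g 0
  set T : ℝ := Real.exp 3 * (D.divisors.card : ℝ) ^ 2 * (D : ℝ) ^ (1 / 4 : ℝ) * (1 + Real.log D) ^ 3 *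
    (1 + |y|) ^ 2 with hT
  have hτ1 : (1 : ℝ) ≤ D.divisors.card := by
    exact_mod_cast Finset.card_pos.2 ⟨1, Nat.one_mem_divisors.2 hD0⟩
  have hD14 : (1 : ℝ) ≤ (D : ℝ) ^ (1 / 4 : ℝ) :=
    Real.one_le_rpow (by exact_mod_cast Nat.one_le_iff_ne_zero.2 hD0) (by norm_num)
  have hT1 : 1 ≤ T := by
    have h1 : (1 : ℝ) ≤ Real.exp 3 := Real.one_le_exp (by norm_num)
    have h2 : (1 : ℝ) ≤ (D.divisors.card : ℝ) ^ 2 := one_le_pow₀ hτ1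
    have h3 : (1 : ℝ) ≤ (1 + Real.log D) ^ 3 := one_le_pow₀ (by linarith)
    have h4 : (1 : ℝ) ≤ (1 + |y|) ^ 2 := one_le_pow₀ (by linarith)
    calc (1 : ℝ) = 1 * 1 * 1 * 1 * 1 := by ring
      _ ≤ T := by rw [hT]; gcongr
  have hg : ‖gFun χ z‖ ≤ 27 * T := by
    have := norm_gFun_line_le χ hprim hD8 hzre
    rw [hzim] at this
    rw [hT]; exact this
  have hg0 : ‖gFun χ 0‖ ≤ 3 * T := by
    have := norm_gFun_zero_le χ hlog hL1
    nlinarith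
  have hq : ‖dslope (gFun χ) 0 z‖ ≤ 120 * T := by
    rw [dslope_of_ne _ hz0, slope_def_field, sub_zero, norm_div, div_le_iff₀ (by linarith)]
    have := norm_sub_le (gFun χ z) (gFun χ 0)
    nlinarith [norm_nonneg (gFun χ z - gFun χ 0)]
  -- combine
  have hE := Real.exp_pos (-(π * |y| / 2))
  have hC := CΓ_pos
  have hAB0 : 0 ≤ A ^ (-(1 / 4) : ℝ) + B ^ (-(1 / 4) : ℝ) := by positivity
  have hT0 : 0 ≤ T := by linarith
  have s1 : ‖riemannZeta₁ (1 + z)‖ ^ 2 * ‖Complex.Gamma (z + 1)‖ ≤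
      (5 ^ 8 * (1 + |y|) ^ 8) * (CΓ * (1 + |y|) ^ 3 * Real.exp (-(π * |y| / 2))) :=
    mul_le_mul hζ2 hΓ (norm_nonneg _) (by positivity)
  have s2 : ‖riemannZeta₁ (1 + z)‖ ^ 2 * ‖Complex.Gamma (z + 1)‖ * ‖eps A B z‖ ≤
      (5 ^ 8 * (1 + |y|) ^ 8) * (CΓ * (1 + |y|) ^ 3 * Real.exp (-(π * |y| / 2))) *
        (4 * (A ^ (-(1 / 4) : ℝ) + B ^ (-(1 / 4) : ℝ))) :=
    mul_le_mul s1 hε (norm_nonneg _) (by positivity)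
  have s3 : ‖riemannZeta₁ (1 + z)‖ ^ 2 * ‖Complex.Gamma (z + 1)‖ * ‖eps A B z‖ *
      ‖dslope (gFun χ) 0 z‖ ≤
      (5 ^ 8 * (1 + |y|) ^ 8) * (CΓ * (1 + |y|) ^ 3 * Real.exp (-(π * |y| / 2))) *
        (4 * (A ^ (-(1 / 4) : ℝ) + B ^ (-(1 / 4) : ℝ))) * (120 * T) :=
    mul_le_mul s2 hq (norm_nonneg _) (by positivity)
  rw [numer, norm_mul, norm_mul, norm_mul, norm_pow]
  refine s3.trans (le_of_eq ?_)
  rw [hT, Kline]; ring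

/-- **The shifted integral**: under the hypotheses of `norm_numer_line_le`,
`‖∫ N(−1/4+iy)/(−1/4+iy) dy‖ ≤ 8 · 28¹³ · K d(D)² D^{1/4} (1+𝓛)³ (A^{-1/4} + B^{-1/4})`.
[cite: Zhang2022LandauSiegel, §3, proof of Lemma 3.1] -/
theorem norm_integral_line_le (hprim : χ.IsPrimitive) (hD8 : 8 ≤ D) (hlog : 1 ≤ Real.log D)
    (hL1 : ‖χ.LFunction 1‖ ≤ 1) {A B : ℝ} (hA : 0 < A) (hB : 0 < B) :
    ‖∫ y : ℝ, numer χ A B ((-(1 / 4) : ℝ) + y * I) / (((-(1 / 4) : ℝ) : ℂ) + y * I - 0)‖ ≤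
      8 * 28 ^ 13 * (Kline * (D.divisors.card : ℝ) ^ 2 * (D : ℝ) ^ (1 / 4 : ℝ) *
        (1 + Real.log D) ^ 3 * (A ^ (-(1 / 4) : ℝ) + B ^ (-(1 / 4) : ℝ))) := by
  set K : ℝ := Kline * (D.divisors.card : ℝ) ^ 2 * (D : ℝ) ^ (1 / 4 : ℝ) * (1 + Real.log D) ^ 3 *
    (A ^ (-(1 / 4) : ℝ) + B ^ (-(1 / 4) : ℝ)) with hK
  have hK0 : 0 ≤ K := by rw [hK]; have := Kline_pos; positivity
  have hbound : ∀ y : ℝ, ‖numer χ A B ((-(1 / 4) : ℝ) + y * I) / (((-(1 / 4) : ℝ) : ℂ) + y * I - 0)‖ ≤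
      4 * K * ((1 + |y|) ^ 13 * Real.exp (-(π * |y| / 2))) := by
    intro y
    have hb := norm_numer_line_le χ hprim hD8 hlog hL1 hA hB y
    rw [← hK] at hb
    rw [sub_zero, norm_div]
    have hw : 1 / 4 ≤ ‖(((-(1 / 4) : ℝ) : ℂ) + y * I)‖ := by
      have hre : ((((-(1 / 4) : ℝ) : ℂ) + y * I)).re = -(1 / 4) := by simp
      have := abs_re_le_norm ((((-(1 / 4) : ℝ) : ℂ) + y * I))
      rw [hre, abs_neg, abs_of_pos (by norm_num : (0 : ℝ) < 1 / 4)] at this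
      exact this
    rw [div_le_iff₀ (by linarith)]
    calc ‖numer χ A B ((-(1 / 4) : ℝ) + y * I)‖ ≤ K * ((1 + |y|) ^ 13 * Real.exp (-(π * |y| / 2))) := hb
      _ = 4 * K * ((1 + |y|) ^ 13 * Real.exp (-(π * |y| / 2))) * (1 / 4) := by ring
      _ ≤ 4 * K * ((1 + |y|) ^ 13 * Real.exp (-(π * |y| / 2))) *
          ‖(((-(1 / 4) : ℝ) : ℂ) + y * I)‖ := by gcongr
  have hint := (integrable_pow_mul_exp 13).const_mul (4 * K)
  calc ‖∫ y : ℝ, numer χ A B ((-(1 / 4) : ℝ) + y * I) / (((-(1 / 4) : ℝ) : ℂ) + y * I - 0)‖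
      ≤ ∫ y : ℝ, 4 * K * ((1 + |y|) ^ 13 * Real.exp (-(π * |y| / 2))) :=
        norm_integral_le_of_norm_le hint (Eventually.of_forall hbound)
    _ = 4 * K * ∫ y : ℝ, (1 + |y|) ^ 13 * Real.exp (-(π * |y| / 2)) := integral_const_mul _ _
    _ ≤ 4 * K * (2 * (2 * (13 : ℕ) + 2) ^ 13) := by
        gcongr; exact integral_pow_mul_exp_le 13
    _ = 8 * 28 ^ 13 * K := by norm_num; ring

end LineBound

/-! ### §9. Bookkeeping in `𝓛 = log D` and the assembly -/

section Assembly

/-- `e³ > 8`, so `log D ≥ 3` forces `D > 8`. [folklore] -/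
theorem eight_lt_exp_three : (8 : ℝ) < Real.exp 3 := by
  have h := Real.exp_one_gt_d9
  have : (2 : ℝ) ^ 3 < Real.exp 1 ^ 3 := pow_lt_pow_left₀ (by linarith) (by norm_num) (by norm_num)
  have e : Real.exp 3 = Real.exp 1 ^ 3 := by rw [Real.exp_one_pow]; norm_num
  rw [e]
  linarith

/-- Elementary facts about `A = D⁴`, `B = P² = exp(2𝓛⁹)` for `𝓛 = log D ≥ 3`. [folklore] -/
theorem aux_AB {D : ℕ} (hL : 3 ≤ Real.log D) :
    0 < ((D : ℝ) ^ 4) ∧ 4 * (D : ℝ) ^ 4 ≤ Real.exp (2 * Real.log D ^ 9) ∧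
    ((D : ℝ) ^ 4) ^ (-(1 / 4) : ℝ) + (Real.exp (2 * Real.log D ^ 9)) ^ (-(1 / 4) : ℝ) ≤ 2 / D ∧
    |Real.log (Real.exp (2 * Real.log D ^ 9)) - Real.log ((D : ℝ) ^ 4)| ≤ 2 * Real.log D ^ 9 ∧
    Real.log (1 + 2 * Real.exp (2 * Real.log D ^ 9)) ≤ 3 * Real.log D ^ 9 := by
  set Lg : ℝ := Real.log D with hLdef
  have hL1 : 1 ≤ Lg := by linarith
  have hD0 : (0 : ℝ) < D := by
    rcases Nat.eq_zero_or_pos D with h | h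
    · rw [h] at hLdef; simp [hLdef] at hL; linarith
    · exact_mod_cast h
  have hDexp : (D : ℝ) = Real.exp Lg := (Real.exp_log hD0).symm
  have hL9 : 3 * Lg ≤ Lg ^ 9 := by
    have h2 : Lg ^ 2 ≤ Lg ^ 9 := pow_le_pow_right₀ hL1 (by norm_num)
    nlinarith
  refine ⟨by positivity, ?_, ?_, ?_, ?_⟩
  · -- `4 D⁴ ≤ exp(2 Lg⁹)`
    have h4 : (4 : ℝ) ≤ Real.exp 2 := by
      have := Real.add_one_le_exp (1 : ℝ)
      have h := Real.exp_one_gt_d9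
      rw [show (2 : ℝ) = 1 + 1 by norm_num, Real.exp_add]; nlinarith
    rw [hDexp, ← Real.exp_nat_mul]
    calc 4 * Real.exp ((4 : ℕ) * Lg) ≤ Real.exp 2 * Real.exp ((4 : ℕ) * Lg) := by gcongr
      _ = Real.exp (2 + 4 * Lg) := by rw [← Real.exp_add]; norm_num
      _ ≤ Real.exp (2 * Lg ^ 9) := Real.exp_le_exp.2 (by nlinarith)
  · -- `A^{-1/4} + B^{-1/4} ≤ 2/D`
    have hA : ((D : ℝ) ^ 4) ^ (-(1 / 4) : ℝ) = (D : ℝ)⁻¹ := by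
      rw [← Real.rpow_natCast, ← Real.rpow_mul hD0.le]
      norm_num
      exact Real.rpow_neg_one _
    have hB : (Real.exp (2 * Lg ^ 9)) ^ (-(1 / 4) : ℝ) ≤ (D : ℝ)⁻¹ := by
      rw [← Real.exp_mul, hDexp, ← Real.exp_neg, Real.exp_le_exp]
      nlinarith
    rw [hA]
    calc (D : ℝ)⁻¹ + (Real.exp (2 * Lg ^ 9)) ^ (-(1 / 4) : ℝ) ≤ (D : ℝ)⁻¹ + (D : ℝ)⁻¹ := by linarith
      _ = 2 / D := by ring
  · -- `|log B − log A| ≤ 2 Lg⁹`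
    rw [Real.log_exp, Real.log_pow, ← hLdef]
    push_cast
    rw [abs_le]; constructor <;> nlinarith
  · -- `log(1 + 2B) ≤ 3 Lg⁹`
    have hE := Real.exp_pos (2 * Lg ^ 9)
    have h1 : 1 + 2 * Real.exp (2 * Lg ^ 9) ≤ 3 * Real.exp (2 * Lg ^ 9) := by
      have := Real.one_le_exp (by positivity : (0:ℝ) ≤ 2 * Lg ^ 9); linarith
    have hlog3 : Real.log 3 ≤ 2 := by
      have := Real.log_le_sub_one_of_pos (by norm_num : (0:ℝ) < 3); linarith
    calc Real.log (1 + 2 * Real.exp (2 * Lg ^ 9)) ≤ Real.log (3 * Real.exp (2 * Lg ^ 9)) :=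
          Real.log_le_log (by positivity) h1
      _ = Real.log 3 + 2 * Lg ^ 9 := by rw [Real.log_mul (by norm_num) hE.ne', Real.log_exp]
      _ ≤ 3 * Lg ^ 9 := by nlinarith

/-- `(1 + 𝓛)³ / D^{1/2} ≤ 8 · 4028^{2014} / 𝓛^{2011}` for `𝓛 = log D ≥ 1`
(`𝓛 ≤ 4028 D^{1/4028}`, Mathlib's `Real.log_le_rpow_div`). [folklore] -/
theorem aux_logpow {D : ℕ} (hL : 1 ≤ Real.log D) (hD0 : (0 : ℝ) < D) :
    (1 + Real.log D) ^ 3 / (D : ℝ) ^ (1 / 2 : ℝ) ≤ 8 * 4028 ^ 2014 / Real.log D ^ 2011 := by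
  set Lg : ℝ := Real.log D with hLdef
  have hL0 : 0 < Lg := by linarith
  have h1 : Lg ≤ (D : ℝ) ^ (1 / 4028 : ℝ) / (1 / 4028) := Real.log_le_rpow_div hD0.le (by norm_num)
  have h2 : Lg / 4028 ≤ (D : ℝ) ^ (1 / 4028 : ℝ) := by
    rw [div_le_iff₀ (by norm_num)]
    have : (D : ℝ) ^ (1 / 4028 : ℝ) / (1 / 4028) = (D : ℝ) ^ (1 / 4028 : ℝ) * 4028 := by ring
    linarith
  have h3 : (Lg / 4028) ^ 2014 ≤ (D : ℝ) ^ (1 / 2 : ℝ) := by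
    calc (Lg / 4028) ^ 2014 ≤ ((D : ℝ) ^ (1 / 4028 : ℝ)) ^ 2014 := pow_le_pow_left₀ (by positivity) h2 _
      _ = (D : ℝ) ^ (1 / 2 : ℝ) := by
          rw [← Real.rpow_natCast, ← Real.rpow_mul hD0.le]; norm_num
  have hDhalf : 0 < (D : ℝ) ^ (1 / 2 : ℝ) := by positivity
  have h4 : (1 + Lg) ^ 3 ≤ 8 * Lg ^ 3 := by
    have : 1 + Lg ≤ 2 * Lg := by linarith
    calc (1 + Lg) ^ 3 ≤ (2 * Lg) ^ 3 := pow_le_pow_left₀ (by linarith) this 3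
      _ = 8 * Lg ^ 3 := by ring
  have h5 : 0 < (Lg / 4028) ^ 2014 := by positivity
  calc (1 + Lg) ^ 3 / (D : ℝ) ^ (1 / 2 : ℝ) ≤ 8 * Lg ^ 3 / (Lg / 4028) ^ 2014 := by
        gcongr
    _ = 8 * 4028 ^ 2014 / Lg ^ 2011 := by
        have hL2014 : Lg ^ 2014 = Lg ^ 3 * Lg ^ 2011 := by rw [← pow_add]
        rw [div_pow, hL2014]
        field_simp

/-- The residue-term bookkeeping: with `r = 𝓛^{-2024}`, `‖Lg(1,χ)‖ ≤ 𝓛^{-2022}` and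
`C_L = 2e^{9/2}(1+𝓛)𝓛`, `3 (‖Lg(1,χ)‖ + C_L r)²/r ≤ 3 (1 + 4e^{9/2})² 𝓛^{-2020}`. [folklore] -/
theorem aux_deriv {Lg X : ℝ} (hL : 1 ≤ Lg) (hX0 : 0 ≤ X) (hX : X ≤ 1 / Lg ^ 2022) :
    3 * (X + 2 * Real.exp (9 / 2) * (1 + Lg) * Lg * (1 / Lg ^ 2024)) ^ 2 / (1 / Lg ^ 2024) ≤
      3 * (1 + 4 * Real.exp (9 / 2)) ^ 2 / Lg ^ 2020 := by
  have hL0 : 0 < Lg := by linarith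
  have hE := Real.exp_pos (9 / 2)
  have h1 : 2 * Real.exp (9 / 2) * (1 + Lg) * Lg * (1 / Lg ^ 2024) ≤ 4 * Real.exp (9 / 2) / Lg ^ 2022 := by
    have h2L : (1 + Lg) * Lg ≤ 2 * Lg ^ 2 := by nlinarith
    rw [show 2 * Real.exp (9 / 2) * (1 + Lg) * Lg * (1 / Lg ^ 2024) =
        2 * Real.exp (9 / 2) * ((1 + Lg) * Lg) / Lg ^ 2024 by ring]
    rw [div_le_div_iff₀ (by positivity) (by positivity)]
    have : Lg ^ 2024 = Lg ^ 2 * Lg ^ 2022 := by rw [← pow_add]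
    rw [this]
    have hm := mul_le_mul_of_nonneg_left h2L hE.le
    nlinarith [hm, pow_pos hL0 2022]
  have h2 : X + 2 * Real.exp (9 / 2) * (1 + Lg) * Lg * (1 / Lg ^ 2024) ≤
      (1 + 4 * Real.exp (9 / 2)) / Lg ^ 2022 := by
    have : (1 + 4 * Real.exp (9 / 2)) / Lg ^ 2022 = 1 / Lg ^ 2022 + 4 * Real.exp (9 / 2) / Lg ^ 2022 := by
      ring
    rw [this]
    linarith
  have h0 : 0 ≤ X + 2 * Real.exp (9 / 2) * (1 + Lg) * Lg * (1 / Lg ^ 2024) := by positivity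
  have h3 : (X + 2 * Real.exp (9 / 2) * (1 + Lg) * Lg * (1 / Lg ^ 2024)) ^ 2 ≤
      ((1 + 4 * Real.exp (9 / 2)) / Lg ^ 2022) ^ 2 := pow_le_pow_left₀ h0 h2 2
  calc 3 * (X + 2 * Real.exp (9 / 2) * (1 + Lg) * Lg * (1 / Lg ^ 2024)) ^ 2 / (1 / Lg ^ 2024)
      = 3 * (X + 2 * Real.exp (9 / 2) * (1 + Lg) * Lg * (1 / Lg ^ 2024)) ^ 2 * Lg ^ 2024 := by
        field_simp
    _ ≤ 3 * ((1 + 4 * Real.exp (9 / 2)) / Lg ^ 2022) ^ 2 * Lg ^ 2024 := by gcongr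
    _ = 3 * (1 + 4 * Real.exp (9 / 2)) ^ 2 / Lg ^ 2020 := by
        have : Lg ^ 4044 = Lg ^ 2024 * Lg ^ 2020 := by rw [← pow_add]
        rw [div_pow, ← pow_mul]
        norm_num
        rw [this]
        field_simp

variable {D : ℕ} [NeZero D] (χ : DirichletCharacter ℂ D)

/-- **Zhang (2022), Lemma 3.1** [cite: Zhang2022LandauSiegel, §3, Lemma 3.1] ("Assume (A)
holds. Then `∑_{D⁴ < n ≤ P²} ν(n)²/n ≪ 𝓛^{-2011}`"), kernel-checked with an explicit threshold:
there is an absolute constant `C` such that for every `D` with `log D ≥ 3`, every PRIMITIVE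
Dirichlet character `χ` mod `D` with `χ² = 1` satisfying (A) `‖Lg(1,χ)‖ ≤ (log D)^{-2022}`, and
every `N ≤ P² = exp(2 (log D)⁹)`,
`∑_{D⁴ < n ≤ N} |ν(n)|²/n ≤ C (log D)^{-2011}`, where `ν(n) = ∑_{d∣n} χ(d)`. -/
theorem lemma_3_1 : ∃ C : ℝ, ∀ (D : ℕ) [NeZero D] (χ : DirichletCharacter ℂ D),
    χ.IsPrimitive → χ ^ 2 = 1 → 3 ≤ Real.log D →
    ‖χ.LFunction 1‖ ≤ 1 / Real.log D ^ 2022 →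
    ∀ N : ℕ, (N : ℝ) ≤ Real.exp (2 * Real.log D ^ 9) →
      ∑ n ∈ Finset.Ioc (D ^ 4) N, ‖divisorSumChar χ n‖ ^ 2 / n ≤ C / Real.log D ^ 2011 := by
  obtain ⟨Cd, hCd1, hCd⟩ := Sieve.exists_card_divisors_le_mul_rpow (by norm_num : (0 : ℝ) < 1 / 8)
  refine ⟨6 * (27 + 6 * (1 + 4 * Real.exp (9 / 2)) ^ 2 +
    16 * 28 ^ 13 * Kline * Cd ^ 2 * (8 * 4028 ^ 2014)), ?_⟩
  intro D _ χ hprim hχ2 hL hA N hN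
  set M : ℝ := (4028 : ℝ) ^ 2014 with hM
  clear_value M
  set Lg : ℝ := Real.log D with hLdef
  have hL1 : 1 ≤ Lg := by linarith
  have hL0 : 0 < Lg := by linarith
  -- `D > 8`
  have hD0 : D ≠ 0 := by
    rintro rfl; simp [hLdef] at hL; linarith
  have hDpos : (0 : ℝ) < D := by exact_mod_cast Nat.pos_of_ne_zero hD0
  have hD8 : 8 ≤ D := by
    have h1 : Real.exp 3 ≤ Real.exp Lg := Real.exp_le_exp.2 hL
    rw [hLdef, Real.exp_log hDpos] at h1
    have := eight_lt_exp_three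
    exact_mod_cast (show (8 : ℝ) ≤ D by linarith)
  have hχ1 := ne_one_of_isPrimitive χ (by omega) hprim
  have hLA1 : ‖χ.LFunction 1‖ ≤ 1 := by
    refine hA.trans ?_
    rw [div_le_one (by positivity)]
    exact one_le_pow₀ hL1
  -- the two cut-offs
  obtain ⟨hApos, h4AB, hABsum, hΔlog, hlogB⟩ := aux_AB (D := D) hL
  set A : ℝ := (D : ℝ) ^ 4 with hAdef
  set B : ℝ := Real.exp (2 * Lg ^ 9) with hBdef
  have hBpos : 0 < B := Real.exp_pos _
  have hAB : A ≤ B := by linarith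
  -- (1) smoothing
  have hS := sum_Ioc_le χ hχ2 hApos h4AB (M := D ^ 4) (N := N) (by rw [hAdef]; push_cast; exact le_rfl) hN
  -- (2) the explicit formula
  have hEF := explicit_formula χ hχ2 hχ1 hApos hBpos
  -- (3) the three terms
  have hg0 : ‖gFun χ 0‖ ≤ 3 * ‖χ.LFunction 1‖ ^ 2 := by
    have hφ1 : ‖phi D (1 + 0)‖ ≤ 3 :=
      norm_phi_one_add_le (N := D) hL1 (by rw [norm_zero]; positivity) (by rw [norm_zero]; norm_num)
    rw [gFun, norm_mul, norm_pow, add_zero]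
    rw [add_zero] at hφ1
    calc ‖χ.LFunction 1‖ ^ 2 * ‖phi D 1‖ ≤ ‖χ.LFunction 1‖ ^ 2 * 3 := by gcongr
      _ = 3 * ‖χ.LFunction 1‖ ^ 2 := by ring
  have hT1 : ‖gFun χ 0 * (W dCoeff B - W dCoeff A)‖ ≤ 27 / Lg ^ 2011 := by
    rw [norm_mul]
    have hW := norm_W_dCoeff_sub_le hApos hAB
    have hLsq : ‖χ.LFunction 1‖ ^ 2 ≤ (1 / Lg ^ 2022) ^ 2 := pow_le_pow_left₀ (norm_nonneg _) hA 2
    have hlog2 : Real.log (1 + 2 * B) ^ 2 ≤ (3 * Lg ^ 9) ^ 2 :=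
      pow_le_pow_left₀ (Real.log_nonneg (by linarith)) hlogB 2
    calc ‖gFun χ 0‖ * ‖W dCoeff B - W dCoeff A‖ ≤ (3 * (1 / Lg ^ 2022) ^ 2) * (3 * Lg ^ 9) ^ 2 := by
          refine mul_le_mul (hg0.trans (by linarith)) (hW.trans hlog2) (norm_nonneg _) (by positivity)
      _ = 27 / Lg ^ 2011 * (1 / Lg ^ 2015) := by field_simp; ring
      _ ≤ 27 / Lg ^ 2011 * 1 := by
          gcongr
          rw [div_le_one (by positivity)]; exact one_le_pow₀ hL1
      _ = 27 / Lg ^ 2011 := by ring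
  have hT2 : ‖((Real.log B : ℂ) - (Real.log A : ℂ)) * deriv (gFun χ) 0‖ ≤
      6 * (1 + 4 * Real.exp (9 / 2)) ^ 2 / Lg ^ 2011 := by
    rw [norm_mul, ← ofReal_sub, Complex.norm_real, Real.norm_eq_abs]
    have hr1 : 1 / Lg ^ 2024 ≤ 1 / Real.log D := by
      rw [← hLdef]
      refine div_le_div_of_nonneg_left (by norm_num) hL0 ?_
      calc Lg = Lg ^ 1 := (pow_one Lg).symm
        _ ≤ Lg ^ 2024 := pow_le_pow_right₀ hL1 (by norm_num)
    have hr4 : 1 / Lg ^ 2024 ≤ 1 / 4 := by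
      refine div_le_div_of_nonneg_left (by norm_num) (by norm_num) ?_
      calc (4 : ℝ) ≤ 3 ^ 2 := by norm_num
        _ ≤ Lg ^ 2 := pow_le_pow_left₀ (by norm_num) hL 2
        _ ≤ Lg ^ 2024 := pow_le_pow_right₀ hL1 (by norm_num)
    have hder := norm_deriv_gFun_zero_le χ hprim hL (r := 1 / Lg ^ 2024) (by positivity) hr1 hr4
    rw [← hLdef] at hder
    have hder' := hder.trans (aux_deriv hL1 (norm_nonneg _) hA)
    calc |Real.log B - Real.log A| * ‖deriv (gFun χ) 0‖
        ≤ (2 * Lg ^ 9) * (3 * (1 + 4 * Real.exp (9 / 2)) ^ 2 / Lg ^ 2020) :=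
          mul_le_mul hΔlog hder' (norm_nonneg _) (by positivity)
      _ = 6 * (1 + 4 * Real.exp (9 / 2)) ^ 2 / Lg ^ 2011 := by
          have : Lg ^ 2020 = Lg ^ 9 * Lg ^ 2011 := by rw [← pow_add]
          rw [this]; field_simp; norm_num
  have hT3 : ‖(1 / (2 * (π : ℂ))) * ∫ y : ℝ, numer χ A B ((-(1 / 4) : ℝ) + y * I) /
      (((-(1 / 4) : ℝ) : ℂ) + y * I - 0)‖ ≤
      16 * 28 ^ 13 * Kline * Cd ^ 2 * (8 * M) / Lg ^ 2011 := by
    rw [norm_mul]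
    have hπ1 : ‖(1 / (2 * (π : ℂ)))‖ ≤ 1 := by
      rw [norm_div, norm_one, norm_mul, Complex.norm_ofNat, Complex.norm_real, Real.norm_eq_abs,
        abs_of_pos Real.pi_pos, div_le_one (by positivity)]
      linarith [Real.pi_gt_three]
    have hI := norm_integral_line_le χ hprim hD8 hL1 hLA1 hApos hBpos
    -- the `D`-bookkeeping: `t = D^{1/8}`
    set t : ℝ := (D : ℝ) ^ (1 / 8 : ℝ) with htdef
    have ht0 : 0 < t := by positivity
    have ht2 : (D : ℝ) ^ (1 / 4 : ℝ) = t ^ 2 := by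
      rw [htdef, ← Real.rpow_natCast, ← Real.rpow_mul hDpos.le]; norm_num
    have ht4 : (D : ℝ) ^ (1 / 2 : ℝ) = t ^ 4 := by
      rw [htdef, ← Real.rpow_natCast, ← Real.rpow_mul hDpos.le]; norm_num
    have ht8 : (D : ℝ) = t ^ 8 := by
      rw [htdef, ← Real.rpow_natCast, ← Real.rpow_mul hDpos.le]; norm_num
    have hτ : (D.divisors.card : ℝ) ≤ Cd * t := hCd D hD0
    have hτ2 : (D.divisors.card : ℝ) ^ 2 ≤ (Cd * t) ^ 2 := pow_le_pow_left₀ (Nat.cast_nonneg _) hτ 2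
    have hlp := aux_logpow (D := D) hL1 hDpos
    rw [ht4, ← hLdef, ← hM] at hlp
    have hK := Kline_pos
    have hmain : Kline * (D.divisors.card : ℝ) ^ 2 * (D : ℝ) ^ (1 / 4 : ℝ) * (1 + Lg) ^ 3 *
        (A ^ (-(1 / 4) : ℝ) + B ^ (-(1 / 4) : ℝ)) ≤
        2 * Kline * Cd ^ 2 * (8 * M / Lg ^ 2011) := by
      calc Kline * (D.divisors.card : ℝ) ^ 2 * (D : ℝ) ^ (1 / 4 : ℝ) * (1 + Lg) ^ 3 *
            (A ^ (-(1 / 4) : ℝ) + B ^ (-(1 / 4) : ℝ))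
          ≤ Kline * (Cd * t) ^ 2 * t ^ 2 * (1 + Lg) ^ 3 * (2 / D) := by
            rw [ht2]; gcongr
        _ = 2 * Kline * Cd ^ 2 * ((1 + Lg) ^ 3 / t ^ 4) := by
            rw [ht8]; field_simp
        _ ≤ 2 * Kline * Cd ^ 2 * (8 * M / Lg ^ 2011) := by gcongr
    calc ‖(1 / (2 * (π : ℂ)))‖ * ‖∫ y : ℝ, numer χ A B ((-(1 / 4) : ℝ) + y * I) /
          (((-(1 / 4) : ℝ) : ℂ) + y * I - 0)‖
        ≤ 1 * (8 * 28 ^ 13 * (Kline * (D.divisors.card : ℝ) ^ 2 * (D : ℝ) ^ (1 / 4 : ℝ) *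
            (1 + Real.log D) ^ 3 * (A ^ (-(1 / 4) : ℝ) + B ^ (-(1 / 4) : ℝ)))) :=
          mul_le_mul hπ1 hI (norm_nonneg _) (by norm_num)
      _ ≤ 1 * (8 * 28 ^ 13 * (2 * Kline * Cd ^ 2 * (8 * M / Lg ^ 2011))) := by
          rw [← hLdef]; gcongr
      _ = 16 * 28 ^ 13 * Kline * Cd ^ 2 * (8 * M) / Lg ^ 2011 := by ring
  -- (4) combine
  have hΔ : ‖W (fun n => divisorSumChar χ n ^ 2) B - W (fun n => divisorSumChar χ n ^ 2) A‖ ≤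
      (27 + 6 * (1 + 4 * Real.exp (9 / 2)) ^ 2 + 16 * 28 ^ 13 * Kline * Cd ^ 2 * (8 * M)) /
        Lg ^ 2011 := by
    rw [hEF]
    refine (norm_add_le _ _).trans ?_
    refine (add_le_add (norm_add_le _ _) le_rfl).trans ?_
    rw [add_div, add_div]
    exact add_le_add (add_le_add hT1 hT2) hT3
  calc ∑ n ∈ Finset.Ioc (D ^ 4) N, ‖divisorSumChar χ n‖ ^ 2 / n
      ≤ 6 * (W (fun n => divisorSumChar χ n ^ 2) B - W (fun n => divisorSumChar χ n ^ 2) A).re := hS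
    _ ≤ 6 * ‖W (fun n => divisorSumChar χ n ^ 2) B - W (fun n => divisorSumChar χ n ^ 2) A‖ := by
        gcongr; exact Complex.re_le_norm _
    _ ≤ 6 * ((27 + 6 * (1 + 4 * Real.exp (9 / 2)) ^ 2 +
          16 * 28 ^ 13 * Kline * Cd ^ 2 * (8 * M)) / Lg ^ 2011) := by gcongr
    _ = _ := by rw [hLdef]; ring

/-- **Lemma 3.1 in the printed shape** `∑_{D⁴ < n ≤ P²}` (`P² = exp(2𝓛⁹)`, (2.6); the sum over the
integers `n ≤ ⌊P²⌋`): under (A), `∑_{D⁴ < n ≤ P²} |ν(n)|²/n ≤ C 𝓛^{-2011}` for `log D ≥ 3`.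
[cite: Zhang2022LandauSiegel, §3, Lemma 3.1] -/
theorem lemma_3_1_floor : ∃ C : ℝ, ∀ (D : ℕ) [NeZero D] (χ : DirichletCharacter ℂ D),
    χ.IsPrimitive → χ ^ 2 = 1 → 3 ≤ Real.log D →
    ‖χ.LFunction 1‖ ≤ 1 / Real.log D ^ 2022 →
      ∑ n ∈ Finset.Ioc (D ^ 4) ⌊Real.exp (2 * Real.log D ^ 9)⌋₊, ‖divisorSumChar χ n‖ ^ 2 / n ≤
        C / Real.log D ^ 2011 := by
  obtain ⟨C, hC⟩ := lemma_3_1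
  exact ⟨C, fun D _ χ hprim hχ2 hL hA =>
    hC D χ hprim hχ2 hL hA _ (Nat.floor_le (Real.exp_pos _).le)⟩

/-- The same with the complex-valued `ν(n)²` of the source (`ν(n)² = |ν(n)|²` for `χ² = 1`):
`‖∑_{D⁴ < n ≤ N} ν(n)²/n‖ ≤ C 𝓛^{-2011}` for `N ≤ P²`. [cite: Zhang2022LandauSiegel, §3, Lemma 3.1] -/
theorem lemma_3_1_complex : ∃ C : ℝ, ∀ (D : ℕ) [NeZero D] (χ : DirichletCharacter ℂ D),
    χ.IsPrimitive → χ ^ 2 = 1 → 3 ≤ Real.log D →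
    ‖χ.LFunction 1‖ ≤ 1 / Real.log D ^ 2022 →
    ∀ N : ℕ, (N : ℝ) ≤ Real.exp (2 * Real.log D ^ 9) →
      ‖∑ n ∈ Finset.Ioc (D ^ 4) N, divisorSumChar χ n ^ 2 / (n : ℂ)‖ ≤ C / Real.log D ^ 2011 := by
  obtain ⟨C, hC⟩ := lemma_3_1
  refine ⟨C, fun D _ χ hprim hχ2 hL hA N hN => ?_⟩
  have h := hC D χ hprim hχ2 hL hA N hN
  have hsum : ∑ n ∈ Finset.Ioc (D ^ 4) N, divisorSumChar χ n ^ 2 / (n : ℂ) =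
      ((∑ n ∈ Finset.Ioc (D ^ 4) N, ‖divisorSumChar χ n‖ ^ 2 / n : ℝ) : ℂ) := by
    push_cast
    refine Finset.sum_congr rfl fun n _ => ?_
    rw [divisorSumChar_sq_eq χ hχ2 n]
    push_cast
    rfl
  rw [hsum, Complex.norm_real, Real.norm_eq_abs, abs_of_nonneg]
  · exact h
  · exact Finset.sum_nonneg fun n _ => by positivity

end Assembly

end Literature.NumberTheory.LFunctions.Zhang2022.Lemma31

end
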